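import Literature.Barriers.Parity.FriedlanderGranvilleUniformityTools
import Literature.NumberTheory.Sieve.ShiftedWindowSieve
import Literature.NumberTheory.Sieve.ElliottHalberstamBridgeProofs
import HarnessLib

/-!
# The Friedlander–Granville matrix: double counting, columns as progressions, dead rows/columns

Topic `Literature/Barriers/Parity` (support file for the proof of
`Literature.Barriers.Parity.FriedlanderGranvilleUniformityBarrier`; Friedlander–Granville,
*Limitations to the equi-distribution of primes III*, Compositio Math. 81 (1992), §5).
Everything here is PROVED; the definitions are elementary bookkeeping objects (the set `D` of
moduli, the entries `a + rq`, row and column counts). Grouping namespace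
`Literature.Barriers.Parity.FriedlanderGranville`.

The matrix (source §5, with `h = 1`, `s ≡ a (mod P)`): for naturals `Q₁ < q ≤ Q₂` with
`q ≡ a (mod P)` (the set `D`, (5.2)) and `1 ≤ r ≤ y`, the entry is the positive integer `a + rq`.
Its rows are the progressions `a (mod q)`, its columns (fixed `r`) the progressions
`a(r+1) (mod rP)` on the segment `(a + rQ₁, a + rQ₂]` (source (5.2):
"`= ∑_{r ≤ y} {π(2rQ + α_r; rP, α_r) − π(rQ + α_r; rP, α_r)} + O(Q/P)`").

* `moduliSet Q₁ Q₂ P a = D`, `entry a r q = (a + rq).toNat`, `rowCount a y q`, `colResidue`,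
  `colEnd` — the objects; `sum_rowCount_eq` — double counting; `card_column_eq_colCount` — each
  column is the prime count `colCount (rP) j_r X₁ʳ X₂ʳ` of `FriedlanderGranvilleUniformityTools`;
* `rowCount_le_one_of_not_coprime`, `colCount_le_one_of_not_coprime` — rows `q` with
  `(q, a) > 1` and columns `r` with `(a(r+1), rP) > 1` contain at most one prime;
* `coprime_colResidue_iff` — (5.6): `(a(r+1), rP) = 1 ↔ (r, a) = 1 ∧ (r + 1, P) = 1` when
  `(a, P) = 1`;
* `rowCount_le_primeCountingModInt`, `primeCountingModInt_le_rowCount_add_one` — a row against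
  `π(x; q, a)` of `FriedlanderGranvilleUniformity.lean`;
* `liveSet`, `card_liveSet_le`, `shiftedSiftedCount_le_card_liveSet`, `card_liveSet_filter_ge` —
  the live columns `(r, a) = 1`, `(r+1, P) = 1` against the sieve count of `ShiftedWindowSieve`;
* `modResidue`, `card_moduliSet_free_eq`, `card_moduliSet_coprime_le_free`,
  `card_moduliSet_free_le_coprime`, `sum_div_totient_moduliSet_le`, `sum_primeWeight_le_card_add` —
  the rows: coprime moduli and the weights `q/φ(q)`, `r'/φ(r')` (source Lemma 3 on average);
* `card_mul_le_sum_columns`, `sum_rows_le`, `sum_primeCounting_div_le` (for (1.5)) and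
  `card_mul_le_sum_rows`, `sum_columns_le` (for (1.6)) — the two sides of the matrix count
  (source (5.3)–(5.8)), with the prime number theorem / Brun–Titchmarsh inputs as hypotheses.

## References

* J. Friedlander, A. Granville, Compositio Math. 81 (1992), §5 (5.2), (5.6) (`FriedlanderGranville1992`).
-/

noncomputable section

open Finset Filter

namespace Literature.Barriers.Parity.FriedlanderGranville

open Literature.NumberTheory.Sieve

/-! ## The objects -/

/-- `D = {Q₁ < q ≤ Q₂ : q ≡ a (mod P)}`, the moduli of the matrix (source (5.2), with `s ≡ a/h`,
`h = 1`). [cite: FriedlanderGranville1992, §5 (5.2)] -/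
def moduliSet (Q₁ Q₂ P : ℕ) (a : ℤ) : Finset ℕ :=
  (Ioc Q₁ Q₂).filter fun q : ℕ ↦ (q : ℤ) ≡ a [ZMOD (P : ℤ)]

/-- The entry `a + rq` of the matrix, as a natural number (it is positive when `q > |a|`). [folklore] -/
def entry (a : ℤ) (r q : ℕ) : ℕ := (a + (r : ℤ) * (q : ℤ)).toNat

/-- The row count `#{1 ≤ r ≤ y : a + rq prime}`. [cite: FriedlanderGranville1992, §5 (5.2)] -/
def rowCount (a : ℤ) (y q : ℕ) : ℕ := #{r ∈ Icc 1 y | (entry a r q).Prime}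

/-- The residue of the column `r`: the natural representative of `a(r+1)` modulo `rP`. [folklore] -/
def colResidue (a : ℤ) (r P : ℕ) : ℕ := ((a * ((r : ℤ) + 1)) % ((r * P : ℕ) : ℤ)).toNat

/-- The ends of the column `r`: `X₁ʳ = a + rQ₁`, `X₂ʳ = a + rQ₂` (natural numbers when `Q₁ ≥ |a|`). [folklore] -/
def colEnd (a : ℤ) (r Qi : ℕ) : ℕ := (a + (r : ℤ) * (Qi : ℤ)).toNat

/-! ## Elementary facts -/

/-- The entry as an integer, when `a + rq ≥ 0`. [folklore] -/
theorem entry_cast {a : ℤ} {r q : ℕ} (h : 0 ≤ a + (r : ℤ) * (q : ℤ)) :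
    ((entry a r q : ℕ) : ℤ) = a + (r : ℤ) * (q : ℤ) := by
  rw [entry, Int.toNat_of_nonneg h]

/-- The column end as an integer, when `a + rQᵢ ≥ 0`. [folklore] -/
theorem colEnd_cast {a : ℤ} {r Qi : ℕ} (h : 0 ≤ a + (r : ℤ) * (Qi : ℤ)) :
    ((colEnd a r Qi : ℕ) : ℤ) = a + (r : ℤ) * (Qi : ℤ) := by
  rw [colEnd, Int.toNat_of_nonneg h]

/-- The column residue as an integer: `a(r+1) mod rP`. [folklore] -/
theorem colResidue_cast (a : ℤ) {r P : ℕ} (hrP : 0 < r * P) :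
    ((colResidue a r P : ℕ) : ℤ) = (a * ((r : ℤ) + 1)) % ((r * P : ℕ) : ℤ) := by
  rw [colResidue, Int.toNat_of_nonneg (Int.emod_nonneg _ (by exact_mod_cast hrP.ne'))]

/-- The column residue is `≡ a(r+1) (mod rP)`. [folklore] -/
theorem colResidue_modEq (a : ℤ) {r P : ℕ} (hrP : 0 < r * P) :
    ((colResidue a r P : ℕ) : ℤ) ≡ a * ((r : ℤ) + 1) [ZMOD ((r * P : ℕ) : ℤ)] := by
  rw [colResidue_cast a hrP]
  exact Int.mod_modEq _ _

/-- Membership in `D`. [folklore] -/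
theorem mem_moduliSet {Q₁ Q₂ P : ℕ} {a : ℤ} {q : ℕ} :
    q ∈ moduliSet Q₁ Q₂ P a ↔ (Q₁ < q ∧ q ≤ Q₂) ∧ (q : ℤ) ≡ a [ZMOD (P : ℤ)] := by
  rw [moduliSet, mem_filter, mem_Ioc]

/-! ## Double counting and the columns as progressions -/

/-- **Double counting**: `∑_{q ∈ D} #{r ≤ y : a + rq prime} = ∑_{r ≤ y} #{q ∈ D : a + rq prime}`.
[cite: FriedlanderGranville1992, §5 (5.2)] -/
theorem sum_rowCount_eq (a : ℤ) (y : ℕ) (D : Finset ℕ) :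
    ∑ q ∈ D, (rowCount a y q : ℝ) = ∑ r ∈ Icc 1 y, (#{q ∈ D | (entry a r q).Prime} : ℝ) := by
  unfold rowCount
  simp_rw [card_filter, Nat.cast_sum]
  rw [sum_comm]

/-- **A column is a segment of a progression** (source (5.2)): for `1 ≤ r`, `1 ≤ P`,
`Q₁ ≤ Q₂` and `0 ≤ a + Q₁` (i.e. `Q₁ ≥ −a`), the primes among the entries `a + rq`, `q ∈ D`,
are the primes `p ≡ a(r+1) (mod rP)` of the segment `(a + rQ₁, a + rQ₂]`:
`#{q ∈ D : a + rq prime} = colCount (rP) (colResidue a r P) (colEnd a r Q₁) (colEnd a r Q₂)`.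
[cite: FriedlanderGranville1992, §5 (5.2)] -/
theorem card_column_eq_colCount {Q₁ Q₂ P r : ℕ} {a : ℤ} (hr : 1 ≤ r) (hP : 1 ≤ P)
    (hQ : Q₁ ≤ Q₂) (ha : 0 ≤ a + Q₁) :
    #{q ∈ moduliSet Q₁ Q₂ P a | (entry a r q).Prime} =
      colCount (r * P) (colResidue a r P) (colEnd a r Q₁) (colEnd a r Q₂) := by
  have hrP : 0 < r * P := Nat.mul_pos hr hP
  have hr0 : (0 : ℤ) < r := by exact_mod_cast hr
  have hX₁ : 0 ≤ a + (r : ℤ) * (Q₁ : ℤ) := by nlinarith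
  have hX₂ : 0 ≤ a + (r : ℤ) * (Q₂ : ℤ) := by
    have : (Q₁ : ℤ) ≤ Q₂ := by exact_mod_cast hQ
    nlinarith
  unfold colCount
  refine card_nbij' (fun q ↦ entry a r q) (fun m ↦ (((m : ℤ) - a) / r).toNat) (fun q hq ↦ ?_)
    (fun m hm ↦ ?_) (fun q hq ↦ ?_) (fun m hm ↦ ?_)
  · -- maps to
    simp only [mem_coe, mem_filter, mem_moduliSet] at hq
    obtain ⟨⟨⟨hq1, hq2⟩, hmod⟩, hprime⟩ := hq
    have hq1' : (Q₁ : ℤ) + 1 ≤ q := by exact_mod_cast hq1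
    have hq2' : (q : ℤ) ≤ Q₂ := by exact_mod_cast hq2
    have hnn : 0 ≤ a + (r : ℤ) * (q : ℤ) := by nlinarith
    simp only [mem_coe, mem_filter, mem_Ioc]
    refine ⟨⟨?_, ?_⟩, hprime, ?_⟩
    · -- `X₁ < entry`
      have : ((colEnd a r Q₁ : ℕ) : ℤ) < ((entry a r q : ℕ) : ℤ) := by
        rw [colEnd_cast hX₁, entry_cast hnn]; nlinarith
      exact_mod_cast this
    · have : ((entry a r q : ℕ) : ℤ) ≤ ((colEnd a r Q₂ : ℕ) : ℤ) := by
        rw [colEnd_cast hX₂, entry_cast hnn]; nlinarith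
      exact_mod_cast this
    · -- the class
      rw [← Int.natCast_modEq_iff, entry_cast hnn]
      refine Int.ModEq.trans ?_ (colResidue_modEq a hrP).symm
      have h1 : (r : ℤ) * (q : ℤ) ≡ (r : ℤ) * a [ZMOD (r : ℤ) * (P : ℤ)] := Int.ModEq.mul_left' hmod
      have h2 : a + (r : ℤ) * (q : ℤ) ≡ a + (r : ℤ) * a [ZMOD (r : ℤ) * (P : ℤ)] := Int.ModEq.add_left a h1
      push_cast
      convert h2 using 2
      ring
  · -- maps back
    simp only [mem_coe, mem_filter, mem_Ioc] at hm
    obtain ⟨⟨hm1, hm2⟩, hprime, hmod⟩ := hm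
    rw [← Int.natCast_modEq_iff] at hmod
    have hmod' := hmod.trans (colResidue_modEq a hrP)
    push_cast at hmod'
    -- `m − a(r+1) = rP t`, so `m − a = r (a + P t)`
    obtain ⟨t, ht⟩ := (Int.modEq_iff_dvd.1 hmod'.symm)
    -- ht : m - a*(r+1) = r*P*t  (up to the order Mathlib uses)
    have hqdef : ((m : ℤ) - a) = r * (a + P * t) := by linarith [ht]
    have hdiv : ((m : ℤ) - a) / r = a + P * t := by
      rw [hqdef, Int.mul_ediv_cancel_left _ hr0.ne']
    have hm1' : ((colEnd a r Q₁ : ℕ) : ℤ) < m := by exact_mod_cast hm1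
    have hm2' : (m : ℤ) ≤ ((colEnd a r Q₂ : ℕ) : ℤ) := by exact_mod_cast hm2
    rw [colEnd_cast hX₁] at hm1'
    rw [colEnd_cast hX₂] at hm2'
    have hq1 : (Q₁ : ℤ) < a + P * t := by nlinarith
    have hq2 : a + P * t ≤ (Q₂ : ℤ) := by nlinarith
    have hqnn : 0 ≤ a + P * t := by
      have : (0 : ℤ) ≤ Q₁ := Nat.cast_nonneg Q₁
      linarith
    simp only [mem_coe, mem_filter, mem_moduliSet]
    rw [hdiv]
    refine ⟨⟨⟨?_, ?_⟩, ?_⟩, ?_⟩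
    · have : ((Q₁ : ℕ) : ℤ) < (((a + ↑P * t).toNat : ℕ) : ℤ) := by
        rw [Int.toNat_of_nonneg hqnn]; exact hq1
      exact_mod_cast this
    · have : (((a + ↑P * t).toNat : ℕ) : ℤ) ≤ ((Q₂ : ℕ) : ℤ) := by
        rw [Int.toNat_of_nonneg hqnn]; exact hq2
      exact_mod_cast this
    · rw [Int.toNat_of_nonneg hqnn]
      exact Int.modEq_iff_dvd.2 ⟨-t, by ring⟩
    · -- the entry is `m` again
      have : entry a r (a + ↑P * t).toNat = m := by
        apply Int.ofNat.inj
        change ((entry a r (a + ↑P * t).toNat : ℕ) : ℤ) = (m : ℤ)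
        rw [entry_cast (by rw [Int.toNat_of_nonneg hqnn]; nlinarith), Int.toNat_of_nonneg hqnn]
        linarith [hqdef]
      rw [this]; exact hprime
  · -- left inverse
    simp only [mem_coe, mem_filter, mem_moduliSet] at hq
    obtain ⟨⟨⟨hq1, hq2⟩, hmod⟩, -⟩ := hq
    have hq1' : (Q₁ : ℤ) + 1 ≤ q := by exact_mod_cast hq1
    have hnn : 0 ≤ a + (r : ℤ) * (q : ℤ) := by nlinarith
    simp only
    rw [entry_cast hnn, show a + (r : ℤ) * q - a = r * q by ring, Int.mul_ediv_cancel_left _ hr0.ne',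
      Int.toNat_natCast]
  · -- right inverse
    simp only [mem_coe, mem_filter, mem_Ioc] at hm
    obtain ⟨⟨hm1, hm2⟩, hprime, hmod⟩ := hm
    rw [← Int.natCast_modEq_iff] at hmod
    have hmod' := hmod.trans (colResidue_modEq a hrP)
    push_cast at hmod'
    obtain ⟨t, ht⟩ := (Int.modEq_iff_dvd.1 hmod'.symm)
    have hqdef : ((m : ℤ) - a) = r * (a + P * t) := by linarith [ht]
    have hdiv : ((m : ℤ) - a) / r = a + P * t := by
      rw [hqdef, Int.mul_ediv_cancel_left _ hr0.ne']
    have hm1' : ((colEnd a r Q₁ : ℕ) : ℤ) < m := by exact_mod_cast hm1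
    rw [colEnd_cast hX₁] at hm1'
    have hq1 : (Q₁ : ℤ) < a + P * t := by nlinarith
    have hqnn : 0 ≤ a + P * t := by
      have : (0 : ℤ) ≤ Q₁ := Nat.cast_nonneg Q₁
      linarith
    simp only
    rw [hdiv]
    apply Int.ofNat.inj
    change ((entry a r (a + ↑P * t).toNat : ℕ) : ℤ) = (m : ℤ)
    rw [entry_cast (by rw [Int.toNat_of_nonneg hqnn]; nlinarith), Int.toNat_of_nonneg hqnn]
    linarith [hqdef]


/-! ## Dead rows and columns -/

/-- **A column whose residue is not reduced contains at most one prime**: if `(j, M) > 1` then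
every `m ≡ j (mod M)` is divisible by a fixed prime, so at most one such `m` is prime. [folklore] -/
theorem colCount_le_one_of_not_coprime {M j : ℕ} (h : ¬ j.Coprime M) (X₁ X₂ : ℕ) :
    colCount M j X₁ X₂ ≤ 1 := by
  set g := Nat.gcd j M with hg
  have hg1 : g ≠ 1 := h
  set p₀ := g.minFac with hp₀
  have hp₀ : p₀.Prime := Nat.minFac_prime hg1
  have hpj : p₀ ∣ j := (Nat.minFac_dvd g).trans (Nat.gcd_dvd_left j M)
  have hpM : p₀ ∣ M := (Nat.minFac_dvd g).trans (Nat.gcd_dvd_right j M)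
  unfold colCount
  refine Finset.card_le_one.2 fun m₁ hm₁ m₂ hm₂ ↦ ?_
  have key : ∀ m ∈ (Ioc X₁ X₂).filter (fun p ↦ p.Prime ∧ p ≡ j [MOD M]), m = p₀ := by
    intro m hm
    rw [mem_filter] at hm
    obtain ⟨-, hmp, hmod⟩ := hm
    have h1 : m ≡ j [MOD p₀] := hmod.of_dvd hpM
    have h2 : p₀ ∣ m := Nat.modEq_zero_iff_dvd.1 (h1.trans (Nat.modEq_zero_iff_dvd.2 hpj))
    exact ((Nat.prime_dvd_prime_iff_eq hp₀ hmp).1 h2).symm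
  rw [key m₁ hm₁, key m₂ hm₂]

/-- **A row `q` with `(q, a) > 1` contains at most one prime** (all its entries are divisible by a
fixed prime). [folklore] -/
theorem rowCount_le_one_of_not_coprime {a : ℤ} {q : ℕ} (hq : 1 ≤ q) (h : Int.gcd (q : ℤ) a ≠ 1)
    (y : ℕ) : rowCount a y q ≤ 1 := by
  set g := Int.gcd (q : ℤ) a with hg
  set p₀ := g.minFac with hp₀
  have hp₀ : p₀.Prime := Nat.minFac_prime h
  have hpq : (p₀ : ℤ) ∣ (q : ℤ) :=
    (Int.natCast_dvd_natCast.2 (Nat.minFac_dvd g)).trans (Int.gcd_dvd_left _ _)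
  have hpa : (p₀ : ℤ) ∣ a := (Int.natCast_dvd_natCast.2 (Nat.minFac_dvd g)).trans (Int.gcd_dvd_right _ _)
  unfold rowCount
  refine Finset.card_le_one.2 fun r₁ hr₁ r₂ hr₂ ↦ ?_
  have key : ∀ r ∈ (Icc 1 y).filter (fun r ↦ (entry a r q).Prime), (entry a r q : ℤ) = p₀ ∧
      0 ≤ a + (r : ℤ) * (q : ℤ) := by
    intro r hr
    rw [mem_filter] at hr
    obtain ⟨-, hpr⟩ := hr
    have hnn : 0 ≤ a + (r : ℤ) * (q : ℤ) := by
      by_contra hneg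
      push Not at hneg
      have : entry a r q = 0 := by rw [entry, Int.toNat_eq_zero]; exact hneg.le
      rw [this] at hpr
      exact Nat.not_prime_zero hpr
    have hdvd : (p₀ : ℤ) ∣ ((entry a r q : ℕ) : ℤ) := by
      rw [entry_cast hnn]
      exact dvd_add hpa (hpq.mul_left _)
    have hdvd' : p₀ ∣ entry a r q := Int.natCast_dvd_natCast.1 hdvd
    refine ⟨?_, hnn⟩
    have := ((Nat.prime_dvd_prime_iff_eq hp₀ hpr).1 hdvd').symm
    rw [this]
  obtain ⟨h1, hn1⟩ := key r₁ hr₁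
  obtain ⟨h2, hn2⟩ := key r₂ hr₂
  rw [entry_cast hn1] at h1
  rw [entry_cast hn2] at h2
  have hq0 : (0 : ℤ) < q := by exact_mod_cast hq
  have : (r₁ : ℤ) * q = (r₂ : ℤ) * q := by linarith
  exact_mod_cast (mul_right_cancel₀ hq0.ne' this)

/-! ## Reduced columns: (5.6) -/

/-- The column residue, as an element of `ZMod (rP)`, is `a(r+1)`. [folklore] -/
theorem colResidue_zmod (a : ℤ) {r P : ℕ} (hrP : 0 < r * P) :
    ((colResidue a r P : ℕ) : ZMod (r * P)) = ((a * ((r : ℤ) + 1) : ℤ) : ZMod (r * P)) := by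
  have h := (ZMod.intCast_eq_intCast_iff _ _ (r * P)).2 (colResidue_modEq a hrP)
  rw [Int.cast_natCast] at h
  exact h

/-- **(5.6)**: for `(a, P) = 1`, the column `r` is reduced, `(a(r+1), rP) = 1`, iff
`(r, a) = 1` and `(r + 1, P) = 1` ("`a + rs ≡ s(h + r) (mod P)` and `(s, P) = 1`", with `h = 1`).
[cite: FriedlanderGranville1992, §5 (5.6)] -/
theorem coprime_colResidue_iff {a : ℤ} {r P : ℕ} (hr : 1 ≤ r) (hP : 1 ≤ P)
    (haP : IsCoprime a (P : ℤ)) :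
    (colResidue a r P).Coprime (r * P) ↔ IsCoprime (r : ℤ) a ∧ (r + 1).Coprime P := by
  have hrP : 0 < r * P := Nat.mul_pos hr hP
  rw [← ZMod.isUnit_iff_coprime, colResidue_zmod a hrP, ZMod.coe_int_isUnit_iff_isCoprime,
    isCoprime_comm, IsCoprime.mul_left_iff]
  push_cast
  rw [IsCoprime.mul_right_iff, IsCoprime.mul_right_iff]
  have h1 : IsCoprime ((r : ℤ) + 1) (r : ℤ) := by
    have : IsCoprime (1 + (r : ℤ) * 1) (r : ℤ) ↔ IsCoprime 1 (r : ℤ) := IsCoprime.add_mul_left_left_iff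
    rw [mul_one, add_comm] at this
    exact this.2 isCoprime_one_left
  have h2 : IsCoprime ((r : ℤ) + 1) (P : ℤ) ↔ (r + 1).Coprime P := by
    rw [← Nat.isCoprime_iff_coprime]; push_cast; exact Iff.rfl
  constructor
  · rintro ⟨⟨har, -⟩, -, hrP'⟩
    exact ⟨har.symm, h2.1 hrP'⟩
  · rintro ⟨hra, hrP'⟩
    exact ⟨⟨hra.symm, haP⟩, h1, h2.2 hrP'⟩

/-! ## A row against `π(x; q, a)` -/

/-- **A row is a progression count**: if `0 ≤ a + q` and `a + yq ≤ x` then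
`rowCount a y q ≤ π(x; q, a)` (`primeCountingModInt`). [cite: FriedlanderGranville1992, §5 (5.2)] -/
theorem rowCount_le_primeCountingModInt {a : ℤ} {y q : ℕ} (hq : 1 ≤ q) (haq : 0 ≤ a + q) {x : ℝ}
    (hx : (a : ℝ) + y * q ≤ x) : rowCount a y q ≤ primeCountingModInt q a x := by
  unfold rowCount primeCountingModInt
  have hq0 : (0 : ℤ) < q := by exact_mod_cast hq
  refine card_le_card_of_injOn (fun r ↦ entry a r q) (fun r hr ↦ ?_) (fun r₁ hr₁ r₂ hr₂ heq ↦ ?_)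
  · rw [mem_coe, mem_filter, mem_Icc] at hr
    obtain ⟨⟨hr1, hry⟩, hpr⟩ := hr
    have hr1' : (1 : ℤ) ≤ r := by exact_mod_cast hr1
    have hnn : 0 ≤ a + (r : ℤ) * (q : ℤ) := by nlinarith
    rw [mem_coe, mem_filter, mem_range, Nat.lt_succ_iff]
    refine ⟨?_, hpr, ?_⟩
    · refine Nat.le_floor ?_
      have h1 : ((entry a r q : ℕ) : ℝ) = (a : ℝ) + r * q := by
        have := entry_cast hnn
        exact_mod_cast this
      rw [h1]
      have hry' : (r : ℝ) ≤ y := by exact_mod_cast hry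
      have hq0' : (0 : ℝ) ≤ q := Nat.cast_nonneg q
      nlinarith
    · rw [entry_cast hnn]
      exact Int.modEq_iff_dvd.2 ⟨-(r : ℤ), by ring⟩
  · rw [mem_coe, mem_filter, mem_Icc] at hr₁ hr₂
    have hn1 : 0 ≤ a + (r₁ : ℤ) * (q : ℤ) := by
      have : (1 : ℤ) ≤ r₁ := by exact_mod_cast hr₁.1.1
      nlinarith
    have hn2 : 0 ≤ a + (r₂ : ℤ) * (q : ℤ) := by
      have : (1 : ℤ) ≤ r₂ := by exact_mod_cast hr₂.1.1
      nlinarith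
    have h := congrArg (fun n : ℕ ↦ (n : ℤ)) heq
    simp only [entry_cast hn1, entry_cast hn2] at h
    have : (r₁ : ℤ) * q = (r₂ : ℤ) * q := by linarith
    exact_mod_cast (mul_right_cancel₀ hq0.ne' this)

/-- **… and conversely up to one prime**: if `|a| < q` and `x ≤ a + yq` then
`π(x; q, a) ≤ rowCount a y q + 1` (the primes `p ≡ a (mod q)`, `p ≤ x`, are entries `a + rq`,
`1 ≤ r ≤ y`, except possibly `p = a`). [cite: FriedlanderGranville1992, §5 (5.2) (the O(Q/P) term)] -/
theorem primeCountingModInt_le_rowCount_add_one {a : ℤ} {y q : ℕ} (haq : (a.natAbs : ℤ) < q)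
    {x : ℝ} (hx : x ≤ (a : ℝ) + y * q) : primeCountingModInt q a x ≤ rowCount a y q + 1 := by
  classical
  unfold rowCount primeCountingModInt
  have hq0 : (0 : ℤ) < q := lt_of_le_of_lt (by positivity) haq
  have habs : -(q : ℤ) < a ∧ a < q := by
    constructor <;> cases Int.natAbs_eq a <;> omega
  -- the primes counted, other than `a` itself, are entries
  have hsub : ((range (⌊x⌋₊ + 1)).filter fun p : ℕ ↦ p.Prime ∧ (p : ℤ) ≡ a [ZMOD (q : ℤ)]) ⊆
      ((Icc 1 y).filter (fun r ↦ (entry a r q).Prime)).image (fun r ↦ entry a r q) ∪ {a.toNat} := by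
    intro p hp
    rw [mem_filter, mem_range, Nat.lt_succ_iff] at hp
    obtain ⟨hpx, hpp, hmod⟩ := hp
    rw [mem_union, mem_image, mem_singleton]
    obtain ⟨m, hm⟩ := Int.modEq_iff_dvd.1 hmod.symm
    -- hm : p - a = q * m, i.e. p = a + m q
    have hp0 : (0 : ℤ) < p := by exact_mod_cast hpp.pos
    by_cases hmz : m = 0
    · right
      rw [hmz, mul_zero, sub_eq_zero] at hm
      rw [← hm, Int.toNat_natCast]
    · left
      have hmpos : 0 < m := by
        by_contra hcon
        push Not at hcon
        have hm1 : m ≤ -1 := by omega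
        nlinarith
      set r : ℤ := m with hr
      have hr1 : 1 ≤ r := by omega
      have hpr : (p : ℤ) = a + r * q := by rw [hr]; linarith
      -- `r ≤ y` from `p ≤ x ≤ a + yq`
      have hxnn : 0 ≤ x := by
        by_contra hneg
        push Not at hneg
        have : ⌊x⌋₊ = 0 := Nat.floor_eq_zero.2 (by linarith)
        rw [this] at hpx
        exact Nat.not_prime_zero (Nat.le_zero.1 hpx ▸ hpp)
      have hpx' : (p : ℝ) ≤ (a : ℝ) + y * q := by
        have h1 : (p : ℝ) ≤ ⌊x⌋₊ := by exact_mod_cast hpx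
        have h2 : (⌊x⌋₊ : ℝ) ≤ x := Nat.floor_le hxnn
        linarith
      have hry : r ≤ y := by
        have h1' : (p : ℝ) = (a : ℝ) + (r : ℝ) * (q : ℝ) := by
          have := congrArg (fun z : ℤ ↦ (z : ℝ)) hpr
          push_cast at this
          exact this
        have hq0' : (0 : ℝ) < q := by exact_mod_cast hq0
        have : (r : ℝ) * q ≤ (y : ℝ) * q := by linarith
        have := le_of_mul_le_mul_right this hq0'
        exact_mod_cast this
      have hrr : ((r.toNat : ℕ) : ℤ) = r := Int.toNat_of_nonneg (by omega)
      have hent : entry a r.toNat q = p := by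
        apply Int.ofNat.inj
        change ((entry a r.toNat q : ℕ) : ℤ) = (p : ℤ)
        rw [entry_cast (by rw [hrr]; linarith), hrr, hpr]
      refine ⟨r.toNat, ?_, hent⟩
      rw [mem_filter, mem_Icc]
      refine ⟨⟨by omega, by omega⟩, ?_⟩
      rw [hent]; exact hpp
  calc #((range (⌊x⌋₊ + 1)).filter fun p : ℕ ↦ p.Prime ∧ (p : ℤ) ≡ a [ZMOD (q : ℤ)])
      ≤ #(((Icc 1 y).filter (fun r ↦ (entry a r q).Prime)).image (fun r ↦ entry a r q) ∪ {a.toNat}) :=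
        card_le_card hsub
    _ ≤ #(((Icc 1 y).filter (fun r ↦ (entry a r q).Prime)).image (fun r ↦ entry a r q)) +
          #({a.toNat} : Finset ℕ) := card_union_le _ _
    _ ≤ #((Icc 1 y).filter (fun r ↦ (entry a r q).Prime)) + 1 := by
        rw [card_singleton]; exact Nat.add_le_add_right card_image_le 1

/-! ## Live columns and the sieve count -/

/-- The live columns: `1 ≤ r ≤ y` with `(r, a) = 1` and `(r + 1, P) = 1` ((5.6)). [cite: FriedlanderGranville1992, §5 (5.6)] -/
def liveSet (a : ℤ) (y P : ℕ) : Finset ℕ :=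
  (Icc 1 y).filter fun r : ℕ ↦ IsCoprime (r : ℤ) a ∧ (r + 1).Coprime P

/-- For a prime `p`: `(p : ℤ) ∣ a ↔ p ∣ |a|`. [folklore] -/
theorem natCast_dvd_iff_dvd_natAbs {p : ℕ} {a : ℤ} : (p : ℤ) ∣ a ↔ p ∣ a.natAbs := by
  rw [← Int.natAbs_dvd_natAbs, Int.natAbs_natCast]

/-- `(r, a) = 1` iff no prime dividing `|a|` divides `r`. [folklore] -/
theorem isCoprime_natCast_iff {r : ℕ} {a : ℤ} :
    IsCoprime (r : ℤ) a ↔ ∀ p : ℕ, p.Prime → p ∣ a.natAbs → ¬ p ∣ r := by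
  rw [Int.isCoprime_iff_gcd_eq_one, Int.gcd_eq_natAbs, Int.natAbs_natCast]
  change Nat.Coprime r a.natAbs ↔ _
  constructor
  · intro h p hp hpa hpr
    exact hp.one_lt.ne' (Nat.Coprime.eq_one_of_dvd (Nat.Coprime.coprime_dvd_left hpr h) hpa)
  · intro h
    exact Nat.coprime_of_dvd fun p hp hpr hpa ↦ h p hp hpa hpr

/-- **The live columns against the sieve count, from above**: if every prime of `T` divides `a`
and `P = ∏_{p ∈ U ∪ S} p` with `U ∪ S` a set of primes, then
`#liveSet ≤ shiftedSiftedCount y T (U ∪ S)`. [folklore] -/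
theorem card_liveSet_le {a : ℤ} {y : ℕ} {T U S : Finset ℕ} (hT : ∀ p ∈ T, p.Prime ∧ p ∣ a.natAbs)
    (hUS : ∀ p ∈ U ∪ S, p.Prime) :
    #(liveSet a y (∏ p ∈ U ∪ S, p)) ≤ ShiftedWindowSieve.shiftedSiftedCount y T (U ∪ S) := by
  unfold liveSet ShiftedWindowSieve.shiftedSiftedCount
  refine card_le_card fun r hr ↦ ?_
  rw [mem_filter] at hr ⊢
  obtain ⟨hr, hcop, hP⟩ := hr
  refine ⟨hr, fun p hp ↦ (isCoprime_natCast_iff.1 hcop) p (hT p hp).1 (hT p hp).2, ?_⟩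
  exact (MaierMatrix.coprime_prod_iff (U ∪ S) hUS (r + 1)).1 hP

/-- **… and from below**: if moreover every prime dividing `a` outside `T` exceeds `w > 0`, then
`shiftedSiftedCount y T (U ∪ S) ≤ #liveSet + ω(|a|) · y/w` (the `r ≤ y` divisible by a prime of
`a` larger than `w` number at most `y/w` for each such prime).
[cite: FriedlanderGranville1992, §3 (proof of Lemma 2, the primes of m₃)] -/
theorem shiftedSiftedCount_le_card_liveSet {a : ℤ} {y : ℕ} {T U S : Finset ℕ} {w : ℝ} (hw : 0 < w)
    (hUS : ∀ p ∈ U ∪ S, p.Prime)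
    (hout : ∀ p : ℕ, p.Prime → p ∣ a.natAbs → p ∉ T → w < p) (ha : a ≠ 0) :
    (ShiftedWindowSieve.shiftedSiftedCount y T (U ∪ S) : ℝ) ≤
      #(liveSet a y (∏ p ∈ U ∪ S, p)) + (a.natAbs.primeFactors.card : ℝ) * (y / w) := by
  classical
  -- the sifted `r` which are not live are divisible by a prime of `a` outside `T`
  set A := (Icc 1 y).filter fun r : ℕ ↦ (∀ p ∈ T, ¬ p ∣ r) ∧ ∀ p ∈ U ∪ S, ¬ p ∣ r + 1 with hA
  set L := liveSet a y (∏ p ∈ U ∪ S, p) with hL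
  set Bad := (a.natAbs.primeFactors.filter fun p ↦ p ∉ T).biUnion
      fun p ↦ (Icc 1 y).filter fun r : ℕ ↦ p ∣ r with hBad
  have hsub : A ⊆ L ∪ Bad := by
    intro r hr
    rw [hA, mem_filter] at hr
    obtain ⟨hr, hTr, hUSr⟩ := hr
    rw [mem_union]
    by_cases hcop : IsCoprime (r : ℤ) a
    · left
      rw [hL, liveSet, mem_filter]
      exact ⟨hr, hcop, (MaierMatrix.coprime_prod_iff (U ∪ S) hUS (r + 1)).2 hUSr⟩
    · right
      rw [isCoprime_natCast_iff] at hcop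
      push Not at hcop
      obtain ⟨p, hp, hpa, hpr⟩ := hcop
      rw [hBad, mem_biUnion]
      refine ⟨p, mem_filter.2 ⟨Nat.mem_primeFactors.2 ⟨hp, hpa, Int.natAbs_ne_zero.2 ha⟩,
        fun hpT ↦ hTr p hpT hpr⟩, mem_filter.2 ⟨hr, hpr⟩⟩
  have hcardBad : (#Bad : ℝ) ≤ (a.natAbs.primeFactors.card : ℝ) * (y / w) := by
    have h1 : (#Bad : ℝ) ≤ ∑ p ∈ a.natAbs.primeFactors.filter (fun p ↦ p ∉ T),
        (#((Icc 1 y).filter fun r : ℕ ↦ p ∣ r) : ℝ) := by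
      rw [hBad]; exact_mod_cast card_biUnion_le
    have h2 : ∀ p ∈ a.natAbs.primeFactors.filter (fun p ↦ p ∉ T),
        (#((Icc 1 y).filter fun r : ℕ ↦ p ∣ r) : ℝ) ≤ y / w := by
      intro p hp
      rw [mem_filter, Nat.mem_primeFactors] at hp
      obtain ⟨⟨hpp, hpa, -⟩, hpT⟩ := hp
      have hwp := hout p hpp hpa hpT
      have hp0 : (0 : ℝ) < p := by exact_mod_cast hpp.pos
      have hIcc : Icc 1 y = Ioc 0 y := by ext n; simp [mem_Icc, mem_Ioc]; omega
      rw [hIcc, Nat.Ioc_filter_dvd_card_eq_div]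
      calc ((y / p : ℕ) : ℝ) ≤ (y : ℝ) / p := Nat.cast_div_le
        _ ≤ y / w := div_le_div_of_nonneg_left (Nat.cast_nonneg y) hw hwp.le
    calc (#Bad : ℝ) ≤ ∑ p ∈ a.natAbs.primeFactors.filter (fun p ↦ p ∉ T),
          (#((Icc 1 y).filter fun r : ℕ ↦ p ∣ r) : ℝ) := h1
      _ ≤ ∑ p ∈ a.natAbs.primeFactors.filter (fun p ↦ p ∉ T), (y : ℝ) / w := sum_le_sum h2
      _ = (#(a.natAbs.primeFactors.filter (fun p ↦ p ∉ T)) : ℝ) * (y / w) := by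
          rw [sum_const, nsmul_eq_mul]
      _ ≤ (a.natAbs.primeFactors.card : ℝ) * (y / w) := by
          refine mul_le_mul_of_nonneg_right ?_ (by positivity)
          exact_mod_cast card_le_card (filter_subset _ _)
  calc (ShiftedWindowSieve.shiftedSiftedCount y T (U ∪ S) : ℝ) = #A := by rw [hA]; rfl
    _ ≤ #(L ∪ Bad) := by exact_mod_cast card_le_card hsub
    _ ≤ #L + #Bad := by exact_mod_cast card_union_le _ _
    _ ≤ #L + (a.natAbs.primeFactors.card : ℝ) * (y / w) := by linarith

/-- The live columns coprime to `K` lose at most `y/K + 1`... in fact at most `⌊y/K⌋`: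
`#liveSet − #{r ∈ liveSet : K ∤ r} ≤ y/K`. [folklore] -/
theorem card_liveSet_filter_ge (a : ℤ) (y P K : ℕ) :
    (#(liveSet a y P) : ℝ) - y / K ≤ #((liveSet a y P).filter fun r ↦ ¬ K ∣ r) := by
  classical
  have h1 : #(liveSet a y P) ≤ #((liveSet a y P).filter fun r ↦ ¬ K ∣ r) +
      #((liveSet a y P).filter fun r ↦ K ∣ r) := by
    rw [add_comm, Finset.card_filter_add_card_filter_not]
  have h2 : #((liveSet a y P).filter fun r ↦ K ∣ r) ≤ y / K := by
    have hIcc : Icc 1 y = Ioc 0 y := by ext n; simp [mem_Icc, mem_Ioc]; omega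
    calc #((liveSet a y P).filter fun r ↦ K ∣ r) ≤ #((Ioc 0 y).filter fun r ↦ K ∣ r) := by
          refine card_le_card fun r hr ↦ ?_
          rw [mem_filter] at hr ⊢
          rw [liveSet, mem_filter, hIcc] at hr
          exact ⟨hr.1.1, hr.2⟩
      _ = y / K := Nat.Ioc_filter_dvd_card_eq_div _ _
  have h3 : ((y / K : ℕ) : ℝ) ≤ (y : ℝ) / K := Nat.cast_div_le
  have h1' : (#(liveSet a y P) : ℝ) ≤ #((liveSet a y P).filter fun r ↦ ¬ K ∣ r) +
      ((y / K : ℕ) : ℝ) := by exact_mod_cast h1.trans (Nat.add_le_add_left h2 _)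
  linarith

/-! ## The rows: coprime moduli and the weight `q/φ(q)` -/

/-- The natural representative of `a` modulo `P`. [folklore] -/
def modResidue (a : ℤ) (P : ℕ) : ℕ := (a % (P : ℤ)).toNat

/-- `modResidue a P ≡ a (mod P)`. [folklore] -/
theorem modResidue_modEq (a : ℤ) {P : ℕ} (hP : 0 < P) :
    ((modResidue a P : ℕ) : ℤ) ≡ a [ZMOD (P : ℤ)] := by
  rw [modResidue, Int.toNat_of_nonneg (Int.emod_nonneg _ (by exact_mod_cast hP.ne'))]
  exact Int.mod_modEq _ _

/-- The congruence defining `D` in natural-number form. [folklore] -/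
theorem int_modEq_iff_modEq_modResidue {a : ℤ} {P : ℕ} (hP : 0 < P) (q : ℕ) :
    (q : ℤ) ≡ a [ZMOD (P : ℤ)] ↔ q ≡ modResidue a P [MOD P] := by
  rw [← Int.natCast_modEq_iff]
  exact ⟨fun h ↦ h.trans (modResidue_modEq a hP).symm, fun h ↦ h.trans (modResidue_modEq a hP)⟩

/-- **The `T`-free moduli of `D` form a sifted progression segment**: for `1 ≤ P`, `Q₁ ≤ Q₂`,
`#{q ∈ D : p ∤ q ∀ p ∈ T} = apSiftedCount Q₁ (Q₂ − Q₁) P (modResidue a P) T`. [folklore] -/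
theorem card_moduliSet_free_eq {Q₁ Q₂ P : ℕ} (hP : 1 ≤ P) (hQ : Q₁ ≤ Q₂) (a : ℤ) (T : Finset ℕ) :
    #((moduliSet Q₁ Q₂ P a).filter fun q ↦ ∀ p ∈ T, ¬ p ∣ q) =
      ShiftedWindowSieve.apSiftedCount Q₁ (Q₂ - Q₁) P (modResidue a P) T := by
  unfold ShiftedWindowSieve.apSiftedCount moduliSet
  rw [filter_filter, Nat.add_sub_cancel' hQ]
  congr 1
  refine filter_congr fun q _ ↦ ?_
  rw [int_modEq_iff_modEq_modResidue hP]

/-- Coprime moduli are `T`-free when `T` consists of primes dividing `a`. [folklore] -/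
theorem card_moduliSet_coprime_le_free {Q₁ Q₂ P : ℕ} {a : ℤ} {T : Finset ℕ}
    (hT : ∀ p ∈ T, p.Prime ∧ p ∣ a.natAbs) :
    #((moduliSet Q₁ Q₂ P a).filter fun q : ℕ ↦ Int.gcd (q : ℤ) a = 1) ≤
      #((moduliSet Q₁ Q₂ P a).filter fun q ↦ ∀ p ∈ T, ¬ p ∣ q) := by
  refine card_le_card fun q hq ↦ ?_
  rw [mem_filter] at hq ⊢
  refine ⟨hq.1, fun p hp ↦ ?_⟩
  have hcop : IsCoprime (q : ℤ) a := Int.isCoprime_iff_gcd_eq_one.2 hq.2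
  exact (isCoprime_natCast_iff.1 hcop) p (hT p hp).1 (hT p hp).2

/-- A class modulo `P` meets the multiples of `e`, `(e, P) = 1`, in at most `(Q₂ − Q₁)/(Pe) + 1`
elements of `(Q₁, Q₂]`. [folklore] -/
theorem card_Ioc_modEq_dvd_le {P e : ℕ} (hP : 0 < P) (he : 0 < e) (hPe : P.Coprime e) (c : ℕ)
    {Q₁ Q₂ : ℕ} (hQ : Q₁ ≤ Q₂) :
    (#((Ioc Q₁ Q₂).filter fun q : ℕ ↦ q ≡ c [MOD P] ∧ e ∣ q) : ℝ) ≤ ((Q₂ : ℝ) - Q₁) / ((P * e : ℕ) : ℝ) + 1 := by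
  rw [BFI.filter_modEq_and_dvd_eq hPe c]
  have := BFI.abs_card_Ioc_filter_modEq_sub_le (Nat.mul_pos hP he) (Nat.chineseRemainder hPe c 0 : ℕ) hQ
  rw [abs_le] at this
  linarith [this.2]

/-- **The `T`-free moduli against the coprime ones**: if every prime dividing `a` outside `T`
exceeds `w > 0` and does not divide `P`, then
`#{q ∈ D : T-free} ≤ #{q ∈ D : (q, a) = 1} + ω(|a|) ((Q₂ − Q₁)/(P w) + 1)`. [folklore] -/
theorem card_moduliSet_free_le_coprime {Q₁ Q₂ P : ℕ} {a : ℤ} {T : Finset ℕ} {w : ℝ} (hw : 0 < w)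
    (hP : 1 ≤ P) (hQ : Q₁ ≤ Q₂) (ha : a ≠ 0)
    (hout : ∀ p : ℕ, p.Prime → p ∣ a.natAbs → p ∉ T → w < p ∧ ¬ p ∣ P) :
    (#((moduliSet Q₁ Q₂ P a).filter fun q ↦ ∀ p ∈ T, ¬ p ∣ q) : ℝ) ≤
      #((moduliSet Q₁ Q₂ P a).filter fun q : ℕ ↦ Int.gcd (q : ℤ) a = 1) +
        (a.natAbs.primeFactors.card : ℝ) * (((Q₂ : ℝ) - Q₁) / (P * w) + 1) := by
  classical
  set A := (moduliSet Q₁ Q₂ P a).filter fun q ↦ ∀ p ∈ T, ¬ p ∣ q with hA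
  set C := (moduliSet Q₁ Q₂ P a).filter fun q : ℕ ↦ Int.gcd (q : ℤ) a = 1 with hC
  set Bad := (a.natAbs.primeFactors.filter fun p ↦ p ∉ T).biUnion
      fun p ↦ (Ioc Q₁ Q₂).filter fun q : ℕ ↦ q ≡ modResidue a P [MOD P] ∧ p ∣ q with hBad
  have hsub : A ⊆ C ∪ Bad := by
    intro q hq
    rw [hA, mem_filter] at hq
    obtain ⟨hqD, hTq⟩ := hq
    rw [mem_union]
    by_cases hcop : Int.gcd (q : ℤ) a = 1
    · exact Or.inl (mem_filter.2 ⟨hqD, hcop⟩)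
    · right
      have hcop' : ¬ IsCoprime (q : ℤ) a := fun h ↦ hcop (Int.isCoprime_iff_gcd_eq_one.1 h)
      rw [isCoprime_natCast_iff] at hcop'
      push Not at hcop'
      obtain ⟨p, hp, hpa, hpq⟩ := hcop'
      rw [hBad, mem_biUnion]
      rw [mem_moduliSet] at hqD
      refine ⟨p, mem_filter.2 ⟨Nat.mem_primeFactors.2 ⟨hp, hpa, Int.natAbs_ne_zero.2 ha⟩,
        fun hpT ↦ hTq p hpT hpq⟩, mem_filter.2 ⟨mem_Ioc.2 hqD.1, ?_, hpq⟩⟩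
      exact (int_modEq_iff_modEq_modResidue hP q).1 hqD.2
  have hcardBad : (#Bad : ℝ) ≤ (a.natAbs.primeFactors.card : ℝ) * (((Q₂ : ℝ) - Q₁) / (P * w) + 1) := by
    have h1 : (#Bad : ℝ) ≤ ∑ p ∈ a.natAbs.primeFactors.filter (fun p ↦ p ∉ T),
        (#((Ioc Q₁ Q₂).filter fun q : ℕ ↦ q ≡ modResidue a P [MOD P] ∧ p ∣ q) : ℝ) := by
      rw [hBad]; exact_mod_cast card_biUnion_le
    have h2 : ∀ p ∈ a.natAbs.primeFactors.filter (fun p ↦ p ∉ T),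
        (#((Ioc Q₁ Q₂).filter fun q : ℕ ↦ q ≡ modResidue a P [MOD P] ∧ p ∣ q) : ℝ) ≤
          ((Q₂ : ℝ) - Q₁) / (P * w) + 1 := by
      intro p hp
      rw [mem_filter, Nat.mem_primeFactors] at hp
      obtain ⟨⟨hpp, hpa, -⟩, hpT⟩ := hp
      obtain ⟨hwp, hpP⟩ := hout p hpp hpa hpT
      have hPp : P.Coprime p := (Nat.coprime_comm.1 ((Nat.Prime.coprime_iff_not_dvd hpp).2 hpP))
      have h3 := card_Ioc_modEq_dvd_le hP hpp.pos hPp (modResidue a P) hQ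
      have h4 : ((Q₂ : ℝ) - Q₁) / ((P * p : ℕ) : ℝ) ≤ ((Q₂ : ℝ) - Q₁) / (P * w) := by
        have hΔ : (0 : ℝ) ≤ (Q₂ : ℝ) - Q₁ := by
          have : (Q₁ : ℝ) ≤ Q₂ := by exact_mod_cast hQ
          linarith
        push_cast
        refine div_le_div_of_nonneg_left hΔ (by positivity) ?_
        exact mul_le_mul_of_nonneg_left hwp.le (Nat.cast_nonneg P)
      linarith
    calc (#Bad : ℝ) ≤ _ := h1
      _ ≤ ∑ p ∈ a.natAbs.primeFactors.filter (fun p ↦ p ∉ T), (((Q₂ : ℝ) - Q₁) / (P * w) + 1) :=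
          sum_le_sum h2
      _ = (#(a.natAbs.primeFactors.filter (fun p ↦ p ∉ T)) : ℝ) * (((Q₂ : ℝ) - Q₁) / (P * w) + 1) := by
          rw [sum_const, nsmul_eq_mul]
      _ ≤ (a.natAbs.primeFactors.card : ℝ) * (((Q₂ : ℝ) - Q₁) / (P * w) + 1) := by
          have hΔ : (0 : ℝ) ≤ ((Q₂ : ℝ) - Q₁) / (P * w) + 1 := by
            have : (Q₁ : ℝ) ≤ Q₂ := by exact_mod_cast hQ
            have : (0 : ℝ) ≤ ((Q₂ : ℝ) - Q₁) / (P * w) := by positivity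
            linarith
          refine mul_le_mul_of_nonneg_right ?_ hΔ
          exact_mod_cast card_le_card (filter_subset _ _)
  calc (#A : ℝ) ≤ #(C ∪ Bad) := by exact_mod_cast card_le_card hsub
    _ ≤ #C + #Bad := by exact_mod_cast card_union_le _ _
    _ ≤ #C + (a.natAbs.primeFactors.card : ℝ) * (((Q₂ : ℝ) - Q₁) / (P * w) + 1) := by linarith

/-- **The weight `q/φ(q)` over the coprime moduli** (source: "`q/φ(q) = 1 + O(1/log log z)`" on
average): let `Ps` be a set of primes all `> m ≥ 1`, none dividing `P`, containing every prime
factor of every `q ∈ D` with `(q, a) = 1`. Then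
`∑_{q ∈ D, (q,a)=1} q/φ(q) ≤ #{q ∈ D : (q, a) = 1} + ((Q₂−Q₁)/P)(e^{1/m} − 1) + (W(Ps)⁻¹ − 1)`.
[cite: FriedlanderGranville1992, §5 (5.8) and §4 Lemma 3] -/
theorem sum_div_totient_moduliSet_le {Q₁ Q₂ P : ℕ} {a : ℤ} {Ps : Finset ℕ} {m : ℕ}
    (hP : 1 ≤ P) (hQ : Q₁ ≤ Q₂) (hm : 1 ≤ m) (hPs : ∀ p ∈ Ps, p.Prime) (hPsm : ∀ p ∈ Ps, m < p)
    (hPsP : ∀ p ∈ Ps, ¬ p ∣ P)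
    (hfac : ∀ q ∈ (moduliSet Q₁ Q₂ P a).filter (fun q : ℕ ↦ Int.gcd (q : ℤ) a = 1), q.primeFactors ⊆ Ps) :
    ∑ q ∈ (moduliSet Q₁ Q₂ P a).filter (fun q : ℕ ↦ Int.gcd (q : ℤ) a = 1), (q : ℝ) / (q.totient : ℝ) ≤
      #((moduliSet Q₁ Q₂ P a).filter fun q : ℕ ↦ Int.gcd (q : ℤ) a = 1) +
        ((Q₂ : ℝ) - Q₁) / P * (Real.exp ((m : ℝ)⁻¹) - 1) + ((MaierMatrix.sieveDensity Ps)⁻¹ - 1) := by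
  classical
  set C := (moduliSet Q₁ Q₂ P a).filter fun q : ℕ ↦ Int.gcd (q : ℤ) a = 1 with hC
  set X : ℝ := ((Q₂ : ℝ) - Q₁) / P with hX
  have hX0 : 0 ≤ X := by
    have : (Q₁ : ℝ) ≤ Q₂ := by exact_mod_cast hQ
    rw [hX]; exact div_nonneg (by linarith) (Nat.cast_nonneg P)
  -- the weight as `primeWeight Ps`
  have hw : ∑ q ∈ C, (q : ℝ) / (q.totient : ℝ) = ∑ q ∈ C, primeWeight Ps q := by
    refine sum_congr rfl fun q hq ↦ div_totient_eq_primeWeight hPs ?_ (hfac q hq)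
    have := (mem_moduliSet.1 (mem_filter.1 hq).1).1.1
    omega
  rw [hw, sum_primeWeight_eq hPs]
  -- each inner count
  have hcount : ∀ t ∈ Ps.powerset, (#(C.filter fun q ↦ (∏ p ∈ t, p) ∣ q) : ℝ) ≤
      X / ((∏ p ∈ t, p : ℕ) : ℝ) + 1 := by
    intro t ht
    have htP : ∀ p ∈ t, p ∈ Ps := fun p hp ↦ mem_powerset.1 ht hp
    have he0 : 0 < ∏ p ∈ t, p := prod_pos fun p hp ↦ (hPs p (htP p hp)).pos
    have hPe : P.Coprime (∏ p ∈ t, p) :=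
      Nat.Coprime.prod_right fun p hp ↦
        (Nat.coprime_comm.1 ((Nat.Prime.coprime_iff_not_dvd (hPs p (htP p hp))).2 (hPsP p (htP p hp))))
    calc (#(C.filter fun q ↦ (∏ p ∈ t, p) ∣ q) : ℝ)
        ≤ #((Ioc Q₁ Q₂).filter fun q : ℕ ↦ q ≡ modResidue a P [MOD P] ∧ (∏ p ∈ t, p) ∣ q) := by
          refine Nat.cast_le.2 (card_le_card fun q hq ↦ ?_)
          rw [mem_filter] at hq ⊢
          have hqD := mem_moduliSet.1 (mem_filter.1 hq.1).1
          exact ⟨mem_Ioc.2 hqD.1, (int_modEq_iff_modEq_modResidue hP q).1 hqD.2, hq.2⟩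
      _ ≤ ((Q₂ : ℝ) - Q₁) / ((P * ∏ p ∈ t, p : ℕ) : ℝ) + 1 := card_Ioc_modEq_dvd_le hP he0 hPe _ hQ
      _ = X / ((∏ p ∈ t, p : ℕ) : ℝ) + 1 := by rw [hX]; push_cast; rw [div_div]
  -- split off `t = ∅`
  have hsplit := (add_sum_erase Ps.powerset
    (fun t ↦ (∏ p ∈ t, ((p : ℝ) - 1)⁻¹) * (#(C.filter fun q ↦ (∏ p ∈ t, p) ∣ q) : ℝ))
    (empty_mem_powerset Ps)).symm
  rw [hsplit]
  simp only [prod_empty, one_mul, one_dvd, filter_true_of_mem (fun _ _ ↦ trivial)]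
  -- the rest
  have hrest : ∑ t ∈ Ps.powerset.erase ∅,
      (∏ p ∈ t, ((p : ℝ) - 1)⁻¹) * (#(C.filter fun q ↦ (∏ p ∈ t, p) ∣ q) : ℝ) ≤
      ∑ t ∈ Ps.powerset.erase ∅, (∏ p ∈ t, ((p : ℝ) - 1)⁻¹) * (X / ((∏ p ∈ t, p : ℕ) : ℝ) + 1) := by
    refine sum_le_sum fun t ht ↦ ?_
    have ht' := mem_of_mem_erase ht
    refine mul_le_mul_of_nonneg_left (hcount t ht') ?_
    exact prod_nonneg fun p hp ↦ by
      have : (2 : ℝ) ≤ p := by exact_mod_cast (hPs p (mem_powerset.1 ht' hp)).two_le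
      have : (0 : ℝ) < (p : ℝ) - 1 := by linarith
      positivity
  have htot := sum_powerset_weight_eq hPs X 1
  rw [← add_sum_erase Ps.powerset _ (empty_mem_powerset Ps)] at htot
  simp only [prod_empty, one_mul, Nat.cast_one, div_one] at htot
  have hE := prod_one_add_le_exp_inv hm hPsm
  have hW := prod_one_add_inv_pred_eq hPs
  rw [hW] at htot
  -- assemble
  have hXE : X * ∏ p ∈ Ps, (1 + ((p : ℝ) * ((p : ℝ) - 1))⁻¹) ≤ X * Real.exp ((m : ℝ)⁻¹) :=
    mul_le_mul_of_nonneg_left hE hX0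
  linarith

/-- **The weight over the live columns** (source: "`r'/φ(r') = 1 + O(1/log log z)`" on average):
for a set of primes `Ps'` all `> m ≥ 1` and a finite set `L` of integers in `[1, y]`,
`∑_{r ∈ L} primeWeight Ps' r ≤ #L + y (e^{1/m} − 1)`. [cite: FriedlanderGranville1992, §5 (after (5.6))] -/
theorem sum_primeWeight_le_card_add {Ps' L : Finset ℕ} {m y : ℕ} (hm : 1 ≤ m)
    (hPs : ∀ p ∈ Ps', p.Prime) (hPsm : ∀ p ∈ Ps', m < p) (hL : L ⊆ Icc 1 y) :
    ∑ r ∈ L, primeWeight Ps' r ≤ #L + y * (Real.exp ((m : ℝ)⁻¹) - 1) := by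
  classical
  rw [sum_primeWeight_eq hPs]
  have hIcc : Icc 1 y = Ioc 0 y := by ext n; simp [mem_Icc, mem_Ioc]; omega
  have hcount : ∀ t ∈ Ps'.powerset, (#(L.filter fun r ↦ (∏ p ∈ t, p) ∣ r) : ℝ) ≤
      (y : ℝ) / ((∏ p ∈ t, p : ℕ) : ℝ) + 0 := by
    intro t ht
    rw [add_zero]
    calc (#(L.filter fun r ↦ (∏ p ∈ t, p) ∣ r) : ℝ) ≤ #((Ioc 0 y).filter fun r ↦ (∏ p ∈ t, p) ∣ r) := by
          refine Nat.cast_le.2 (card_le_card fun r hr ↦ ?_)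
          rw [mem_filter] at hr ⊢
          exact ⟨hIcc ▸ hL hr.1, hr.2⟩
      _ = ((y / ∏ p ∈ t, p : ℕ) : ℝ) := by rw [Nat.Ioc_filter_dvd_card_eq_div]
      _ ≤ (y : ℝ) / ((∏ p ∈ t, p : ℕ) : ℝ) := Nat.cast_div_le
  have hsplit := (add_sum_erase Ps'.powerset
    (fun t ↦ (∏ p ∈ t, ((p : ℝ) - 1)⁻¹) * (#(L.filter fun r ↦ (∏ p ∈ t, p) ∣ r) : ℝ))
    (empty_mem_powerset Ps')).symm
  rw [hsplit]
  simp only [prod_empty, one_mul, one_dvd, filter_true_of_mem (fun _ _ ↦ trivial)]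
  have hrest : ∑ t ∈ Ps'.powerset.erase ∅,
      (∏ p ∈ t, ((p : ℝ) - 1)⁻¹) * (#(L.filter fun r ↦ (∏ p ∈ t, p) ∣ r) : ℝ) ≤
      ∑ t ∈ Ps'.powerset.erase ∅, (∏ p ∈ t, ((p : ℝ) - 1)⁻¹) * ((y : ℝ) / ((∏ p ∈ t, p : ℕ) : ℝ) + 0) := by
    refine sum_le_sum fun t ht ↦ ?_
    have ht' := mem_of_mem_erase ht
    refine mul_le_mul_of_nonneg_left (hcount t ht') ?_
    exact prod_nonneg fun p hp ↦ by
      have : (2 : ℝ) ≤ p := by exact_mod_cast (hPs p (mem_powerset.1 ht' hp)).two_le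
      have : (0 : ℝ) < (p : ℝ) - 1 := by linarith
      positivity
  have htot := sum_powerset_weight_eq hPs (y : ℝ) 0
  rw [← add_sum_erase Ps'.powerset _ (empty_mem_powerset Ps')] at htot
  simp only [prod_empty, one_mul, Nat.cast_one, div_one, zero_mul, add_zero] at htot
  have hE := prod_one_add_le_exp_inv hm hPsm
  have hyE : (y : ℝ) * ∏ p ∈ Ps', (1 + ((p : ℝ) * ((p : ℝ) - 1))⁻¹) ≤ y * Real.exp ((m : ℝ)⁻¹) :=
    mul_le_mul_of_nonneg_left hE (Nat.cast_nonneg y)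
  simp only [add_zero] at hrest
  linarith

/-! ## Totients of the column moduli -/

/-- `φ(rP) ≤ r φ(P)`. [folklore] -/
theorem totient_mul_le {r P : ℕ} (hr : r ≠ 0) (hP : P ≠ 0) :
    ((r * P).totient : ℝ) ≤ r * (P.totient : ℝ) := by
  classical
  set Ps := r.primeFactors.filter fun p ↦ ¬ p ∣ P with hPs
  have hPsp : ∀ p ∈ Ps, p.Prime := fun p hp ↦ Nat.prime_of_mem_primeFactors (mem_filter.1 hp).1
  have h := totient_mul_weight hPsp hr hP (fun p hp hnd ↦ mem_filter.2 ⟨hp, hnd⟩)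
    (fun p hp ↦ (mem_filter.1 hp).2)
  have hw := one_le_primeWeight hPsp r
  have h0 : (0 : ℝ) ≤ ((r * P).totient : ℝ) := Nat.cast_nonneg _
  nlinarith

/-- `φ(P) ≤ φ(rP)` for `r ≥ 1`. [folklore] -/
theorem totient_le_totient_mul {r P : ℕ} (hr : 1 ≤ r) :
    (P.totient : ℝ) ≤ ((r * P).totient : ℝ) := by
  have h1 := Nat.totient_super_multiplicative r P
  have h2 : 1 ≤ r.totient := Nat.totient_pos.2 hr
  have h3 : P.totient ≤ r.totient * P.totient := Nat.le_mul_of_pos_left _ h2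
  exact_mod_cast h3.trans h1

/-! ## The columns, from below (for (1.5)) -/

set_option maxHeartbeats 800000 in
/-- **The sum of the columns from below** (source (5.3), (5.5), (5.7)): with the prime number
theorem `|ψ(x; rP, a(r+1)) − x/φ(rP)| ≤ ε x/φ(rP)` for `x ≥ X` available for the live columns
`r` with `K ∤ r` ("good moduli"), every such column contains at least
`([(Q₂−Q₁) − ε(3Q₁+Q₂) − (1+ε)X]/φ(P) − 2√X_max log X_max)/log X_max` primes
(`X_max ≥ a + yQ₂`), whence the displayed lower bound for the total number of primes in the
matrix. [cite: FriedlanderGranville1992, §5 (5.3), (5.5), (5.7)] -/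
theorem card_mul_le_sum_columns {Q₁ Q₂ P y K X : ℕ} {a : ℤ} {ε Xmax : ℝ}
    (hP : 1 ≤ P) (hQ : Q₁ ≤ Q₂) (ha : a.natAbs ≤ Q₁) (hX2 : 2 ≤ X)
    (hXQ : (X : ℝ) ≤ (a : ℝ) + Q₂) (hXmax : (a : ℝ) + y * Q₂ ≤ Xmax) (hXmax2 : 2 ≤ Xmax)
    (hε : 0 ≤ ε) (hΔ : 0 ≤ ((Q₂ : ℝ) - Q₁) - ε * (3 * Q₁ + Q₂))
    (hψ : ∀ r ∈ (liveSet a y P).filter (fun r ↦ ¬ K ∣ r), ∀ x : ℝ, (X : ℝ) ≤ x →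
      |ParityWave0.chebyshevPsiMod (r * P) ((colResidue a r P : ℕ) : ZMod (r * P)) x -
          x / ((r * P).totient : ℝ)| ≤ ε * (x / ((r * P).totient : ℝ))) :
    (#((liveSet a y P).filter fun r ↦ ¬ K ∣ r) : ℝ) *
        ((((Q₂ : ℝ) - Q₁) - ε * (3 * Q₁ + Q₂) - (1 + ε) * X) / (P.totient : ℝ) -
          2 * Real.sqrt Xmax * Real.log Xmax) ≤
      Real.log Xmax * ∑ r ∈ Icc 1 y, (#{q ∈ moduliSet Q₁ Q₂ P a | (entry a r q).Prime} : ℝ) := by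
  classical
  set G := (liveSet a y P).filter fun r ↦ ¬ K ∣ r with hG
  set R₀ : ℝ := (((Q₂ : ℝ) - Q₁) - ε * (3 * Q₁ + Q₂) - (1 + ε) * X) / (P.totient : ℝ) -
    2 * Real.sqrt Xmax * Real.log Xmax with hR₀
  have hφP : (0 : ℝ) < P.totient := by exact_mod_cast Nat.totient_pos.2 hP
  have haQ₁ : -(Q₁ : ℤ) ≤ a ∧ a ≤ Q₁ := by
    have h := ha; constructor <;> cases Int.natAbs_eq a <;> omega
  have ha0 : 0 ≤ a + Q₁ := by linarith [haQ₁.1]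
  have hX0 : (0 : ℝ) < X := by exact_mod_cast (by omega : 0 < X)
  have hX2R : (2 : ℝ) ≤ X := by exact_mod_cast hX2
  have hlogXmax : 0 ≤ Real.log Xmax := Real.log_nonneg (by linarith)
  have hGsub : G ⊆ Icc 1 y := (filter_subset _ _).trans (filter_subset _ _)
  -- every good live column has at least `R₀ / log Xmax` primes
  have hcol : ∀ r ∈ G, R₀ ≤ Real.log Xmax * (#{q ∈ moduliSet Q₁ Q₂ P a | (entry a r q).Prime} : ℝ) := by
    intro r hrG
    have hr := hGsub hrG
    rw [mem_Icc] at hr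
    obtain ⟨hr1, hry⟩ := hr
    have hrG' := hrG
    rw [hG, mem_filter, liveSet, mem_filter] at hrG'
    obtain ⟨⟨-, hcopa, hcopP⟩, -⟩ := hrG'
    set M := r * P with hM
    set j := colResidue a r P with hj
    set X₁ := colEnd a r Q₁ with hX₁
    set X₂ := colEnd a r Q₂ with hX₂def
    have hM0 : 0 < M := Nat.mul_pos hr1 hP
    have hr0 : (0 : ℤ) < r := by exact_mod_cast hr1
    have hr1R : (1 : ℝ) ≤ r := by exact_mod_cast hr1
    have hryR : (r : ℝ) ≤ y := by exact_mod_cast hry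
    -- the ends as integers / reals
    have hX₁nn : 0 ≤ a + (r : ℤ) * (Q₁ : ℤ) := by nlinarith
    have hX₂nn : 0 ≤ a + (r : ℤ) * (Q₂ : ℤ) := by
      have : (Q₁ : ℤ) ≤ Q₂ := by exact_mod_cast hQ
      nlinarith
    have hX₁R : ((X₁ : ℕ) : ℝ) = (a : ℝ) + r * Q₁ := by
      have := colEnd_cast hX₁nn; rw [← hX₁] at this; exact_mod_cast this
    have hX₂R : ((X₂ : ℕ) : ℝ) = (a : ℝ) + r * Q₂ := by
      have := colEnd_cast hX₂nn; rw [← hX₂def] at this; exact_mod_cast this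
    have hQ₁R : (0 : ℝ) ≤ Q₁ := Nat.cast_nonneg Q₁
    have hQ₂R : (Q₁ : ℝ) ≤ Q₂ := by exact_mod_cast hQ
    have haR : (a : ℝ) ≤ Q₁ := by exact_mod_cast haQ₁.2
    have hX₁X₂ : X₁ ≤ X₂ := by
      have : ((X₁ : ℕ) : ℝ) ≤ X₂ := by rw [hX₁R, hX₂R]; nlinarith
      exact_mod_cast this
    have hXX₂ : (X : ℝ) ≤ X₂ := by
      rw [hX₂R]
      have : (Q₂ : ℝ) ≤ r * Q₂ := by nlinarith
      linarith
    have hX₂pos : (0 : ℝ) < X₂ := lt_of_lt_of_le hX0 hXX₂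
    have hX₂max : ((X₂ : ℕ) : ℝ) ≤ Xmax := by
      rw [hX₂R]
      have : (r : ℝ) * Q₂ ≤ y * Q₂ := by nlinarith
      linarith
    -- the column as a progression count
    have hC : #{q ∈ moduliSet Q₁ Q₂ P a | (entry a r q).Prime} = colCount M j X₁ X₂ :=
      card_column_eq_colCount hr1 hP hQ ha0
    rw [hC]
    -- Chebyshev bounds
    have hlow := colCount_mul_log_ge M j hX₁X₂
    have hψ₂ := hψ r hrG (X₂ : ℝ) hXX₂
    have hψ₁ : ParityWave0.chebyshevPsiMod M (j : ZMod M) X₁ ≤ (1 + ε) * ((((max X₁ X : ℕ) : ℝ)) / (M.totient : ℝ)) := by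
      have hmax : (X : ℝ) ≤ ((max X₁ X : ℕ) : ℝ) := by exact_mod_cast le_max_right X₁ X
      have h1 := hψ r hrG ((max X₁ X : ℕ) : ℝ) hmax
      have h2 : ParityWave0.chebyshevPsiMod M (j : ZMod M) X₁ ≤
          ParityWave0.chebyshevPsiMod M (j : ZMod M) ((max X₁ X : ℕ) : ℝ) :=
        chebyshevPsiMod_mono M _ (by exact_mod_cast le_max_left X₁ X)
      rw [abs_le] at h1
      linarith [h1.2]
    have hmaxle : (((max X₁ X : ℕ) : ℝ)) ≤ (X₁ : ℝ) + X := by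
      rcases le_total X₁ X with h | h
      · rw [max_eq_right h]; linarith [(Nat.cast_nonneg X₁ : (0 : ℝ) ≤ X₁)]
      · rw [max_eq_left h]; linarith
    have hcheb : Chebyshev.psi X₂ - Chebyshev.theta X₂ ≤ 2 * Real.sqrt Xmax * Real.log Xmax := by
      have h1 := Chebyshev.abs_psi_sub_theta_le_sqrt_mul_log (x := (X₂ : ℝ)) (by linarith)
      rw [abs_le] at h1
      have h2 : Real.sqrt X₂ ≤ Real.sqrt Xmax := Real.sqrt_le_sqrt hX₂max
      have h3 : Real.log X₂ ≤ Real.log Xmax := Real.log_le_log hX₂pos hX₂max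
      have h4 : 0 ≤ Real.log (X₂ : ℝ) := Real.log_nonneg (by linarith)
      have h5 : 0 ≤ Real.sqrt Xmax := Real.sqrt_nonneg _
      calc Chebyshev.psi X₂ - Chebyshev.theta X₂ ≤ 2 * Real.sqrt X₂ * Real.log X₂ := h1.2
        _ ≤ 2 * Real.sqrt Xmax * Real.log X₂ :=
            mul_le_mul_of_nonneg_right (mul_le_mul_of_nonneg_left h2 (by norm_num)) h4
        _ ≤ 2 * Real.sqrt Xmax * Real.log Xmax := mul_le_mul_of_nonneg_left h3 (by positivity)
    -- totients
    have hφM : (0 : ℝ) < M.totient := by exact_mod_cast Nat.totient_pos.2 hM0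
    have hφ1 : (P.totient : ℝ) ≤ M.totient := totient_le_totient_mul hr1
    have hφ2 : (M.totient : ℝ) ≤ r * P.totient := totient_mul_le (by omega) (by omega)
    -- main term
    rw [abs_le] at hψ₂
    have hA : (1 - ε) * ((X₂ : ℝ) / M.totient) - (1 + ε) * (((X₁ : ℝ) + X) / M.totient) -
        2 * Real.sqrt Xmax * Real.log Xmax ≤ (colCount M j X₁ X₂ : ℝ) * Real.log X₂ := by
      have h1 : (1 + ε) * ((((max X₁ X : ℕ) : ℝ)) / (M.totient : ℝ)) ≤ (1 + ε) * (((X₁ : ℝ) + X) / M.totient) :=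
        mul_le_mul_of_nonneg_left (div_le_div_of_nonneg_right hmaxle hφM.le) (by linarith)
      linarith [hψ₂.1, hlow]
    -- `(1-ε)X₂ − (1+ε)X₁ ≥ r[(Q₂−Q₁) − ε(3Q₁+Q₂)]`
    have hB : (r : ℝ) * (((Q₂ : ℝ) - Q₁) - ε * (3 * Q₁ + Q₂)) ≤ (1 - ε) * (X₂ : ℝ) - (1 + ε) * X₁ := by
      rw [hX₁R, hX₂R]
      have : (a : ℝ) ≤ r * Q₁ := by nlinarith
      nlinarith
    -- divide by `φ(M)` and compare with `φ(P)`
    have hCD : (r : ℝ) * (((Q₂ : ℝ) - Q₁) - ε * (3 * Q₁ + Q₂)) / M.totient ≥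
        (((Q₂ : ℝ) - Q₁) - ε * (3 * Q₁ + Q₂)) / P.totient := by
      rw [ge_iff_le, div_le_div_iff₀ hφP hφM]
      calc (((Q₂ : ℝ) - Q₁) - ε * (3 * Q₁ + Q₂)) * M.totient
          ≤ (((Q₂ : ℝ) - Q₁) - ε * (3 * Q₁ + Q₂)) * (r * P.totient) :=
            mul_le_mul_of_nonneg_left hφ2 hΔ
        _ = r * (((Q₂ : ℝ) - Q₁) - ε * (3 * Q₁ + Q₂)) * P.totient := by ring
    have hXterm : (1 + ε) * (X : ℝ) / M.totient ≤ (1 + ε) * X / P.totient :=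
      div_le_div_of_nonneg_left (by positivity) hφP hφ1
    have hkey : R₀ ≤ (colCount M j X₁ X₂ : ℝ) * Real.log X₂ := by
      have e1 : (1 - ε) * ((X₂ : ℝ) / M.totient) - (1 + ε) * (((X₁ : ℝ) + X) / M.totient) =
          ((1 - ε) * (X₂ : ℝ) - (1 + ε) * X₁) / M.totient - (1 + ε) * X / M.totient := by
        field_simp; ring
      have e2 : (r : ℝ) * (((Q₂ : ℝ) - Q₁) - ε * (3 * Q₁ + Q₂)) / M.totient ≤
          ((1 - ε) * (X₂ : ℝ) - (1 + ε) * X₁) / M.totient := div_le_div_of_nonneg_right hB hφM.le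
      have e3 : R₀ = (((Q₂ : ℝ) - Q₁) - ε * (3 * Q₁ + Q₂)) / P.totient - (1 + ε) * X / P.totient -
          2 * Real.sqrt Xmax * Real.log Xmax := by rw [hR₀]; ring
      rw [e1] at hA
      rw [e3]
      linarith [hCD]
    -- finally `log X₂ ≤ log Xmax`
    have hlog : (colCount M j X₁ X₂ : ℝ) * Real.log X₂ ≤ Real.log Xmax * colCount M j X₁ X₂ := by
      rw [mul_comm]
      exact mul_le_mul_of_nonneg_right (Real.log_le_log hX₂pos hX₂max) (Nat.cast_nonneg _)
    linarith
  -- sum over the good live columns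
  calc (#G : ℝ) * R₀ = ∑ r ∈ G, R₀ := by rw [sum_const, nsmul_eq_mul]
    _ ≤ ∑ r ∈ G, Real.log Xmax * (#{q ∈ moduliSet Q₁ Q₂ P a | (entry a r q).Prime} : ℝ) := sum_le_sum hcol
    _ ≤ ∑ r ∈ Icc 1 y, Real.log Xmax * (#{q ∈ moduliSet Q₁ Q₂ P a | (entry a r q).Prime} : ℝ) :=
        sum_le_sum_of_subset_of_nonneg hGsub fun r _ _ ↦ by positivity
    _ = Real.log Xmax * ∑ r ∈ Icc 1 y, (#{q ∈ moduliSet Q₁ Q₂ P a | (entry a r q).Prime} : ℝ) := by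
        rw [mul_sum]


/-! ## The rows, from above (for (1.5)) -/

/-- `rowCount ≤ y`. [folklore] -/
theorem rowCount_le (a : ℤ) (y q : ℕ) : rowCount a y q ≤ y := by
  unfold rowCount
  calc #((Icc 1 y).filter fun r ↦ (entry a r q).Prime) ≤ #(Icc 1 y) := card_filter_le _ _
    _ = y := by simp

/-- **The sum of the rows from above** (source, the display before (5.8)): if every modulus of
`D` exceeds `|a|` and `a + yq ≤ q log^N q` on `D`, then, writing `x_q = q log^N q`,
`∑_{q ∈ D} #{r ≤ y : a + rq prime} ≤ #D + y · #{violators of (1.5)} + (1+δ) ∑_{q ∈ D, (q,a)=1} π(x_q)/φ(q)`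
(rows with `(q, a) > 1` hold at most one prime, violating rows at most `y`, the others at most
`π(x_q; q, a) ≤ (1 + δ) π(x_q)/φ(q)`). [cite: FriedlanderGranville1992, §5 (5.8)] -/
theorem sum_rows_le {Q₁ Q₂ P y : ℕ} {a : ℤ} {N δ : ℝ} (ha : a.natAbs ≤ Q₁) (hδ : 0 ≤ δ)
    (hy : ∀ q ∈ moduliSet Q₁ Q₂ P a, (a : ℝ) + y * q ≤ q * Real.log q ^ N) :
    ∑ q ∈ moduliSet Q₁ Q₂ P a, (rowCount a y q : ℝ) ≤
      #(moduliSet Q₁ Q₂ P a) +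
        y * #(((moduliSet Q₁ Q₂ P a).filter fun q : ℕ ↦ Int.gcd (q : ℤ) a = 1).filter fun q : ℕ ↦
          (1 + δ) * ((Nat.primeCounting ⌊(q : ℝ) * Real.log q ^ N⌋₊ : ℝ) / (Nat.totient q : ℝ)) <
            (primeCountingModInt q a ((q : ℝ) * Real.log q ^ N) : ℝ)) +
        (1 + δ) * ∑ q ∈ (moduliSet Q₁ Q₂ P a).filter (fun q : ℕ ↦ Int.gcd (q : ℤ) a = 1),
          (Nat.primeCounting ⌊(q : ℝ) * Real.log q ^ N⌋₊ : ℝ) / (Nat.totient q : ℝ) := by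
  classical
  set D := moduliSet Q₁ Q₂ P a with hD
  set viol : ℕ → Prop := fun q ↦
    (1 + δ) * ((Nat.primeCounting ⌊(q : ℝ) * Real.log q ^ N⌋₊ : ℝ) / (Nat.totient q : ℝ)) <
      (primeCountingModInt q a ((q : ℝ) * Real.log q ^ N) : ℝ) with hviol
  set g : ℕ → ℝ := fun q ↦ (Nat.primeCounting ⌊(q : ℝ) * Real.log q ^ N⌋₊ : ℝ) / (Nat.totient q : ℝ) with hg
  have hg0 : ∀ q, 0 ≤ g q := fun q ↦ by rw [hg]; positivity
  have hpt : ∀ q ∈ D, (rowCount a y q : ℝ) ≤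
      1 + (if Int.gcd (q : ℤ) a = 1 ∧ viol q then (y : ℝ) else 0) +
        (if Int.gcd (q : ℤ) a = 1 then (1 + δ) * g q else 0) := by
    intro q hq
    have hqD := mem_moduliSet.1 hq
    have hq1 : Q₁ + 1 ≤ q := hqD.1.1
    have hqa : a.natAbs < q := by omega
    by_cases hcop : Int.gcd (q : ℤ) a = 1
    · by_cases hv : viol q
      · rw [if_pos ⟨hcop, hv⟩, if_pos hcop]
        have h1 : (rowCount a y q : ℝ) ≤ y := by exact_mod_cast rowCount_le a y q
        have h2 : 0 ≤ (1 + δ) * g q := mul_nonneg (by linarith) (hg0 q)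
        linarith
      · rw [if_neg (fun h ↦ hv h.2), if_pos hcop]
        have haq : 0 ≤ a + q := by
          have : -(q : ℤ) < a := by cases Int.natAbs_eq a <;> omega
          linarith
        have h1 : rowCount a y q ≤ primeCountingModInt q a ((q : ℝ) * Real.log q ^ N) :=
          rowCount_le_primeCountingModInt (by omega) haq (hy q hq)
        have h1' : (rowCount a y q : ℝ) ≤ primeCountingModInt q a ((q : ℝ) * Real.log q ^ N) := by
          exact_mod_cast h1
        have h2 : (primeCountingModInt q a ((q : ℝ) * Real.log q ^ N) : ℝ) ≤ (1 + δ) * g q := by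
          rw [hviol] at hv; push Not at hv; exact hv
        linarith
    · rw [if_neg (fun h ↦ hcop h.1), if_neg hcop]
      have h1 : (rowCount a y q : ℝ) ≤ 1 := by
        exact_mod_cast rowCount_le_one_of_not_coprime (by omega) hcop y
      linarith
  calc ∑ q ∈ D, (rowCount a y q : ℝ)
      ≤ ∑ q ∈ D, (1 + (if Int.gcd (q : ℤ) a = 1 ∧ viol q then (y : ℝ) else 0) +
          (if Int.gcd (q : ℤ) a = 1 then (1 + δ) * g q else 0)) := sum_le_sum hpt
    _ = #D + y * #((D.filter fun q : ℕ ↦ Int.gcd (q : ℤ) a = 1).filter viol) +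
          (1 + δ) * ∑ q ∈ D.filter (fun q : ℕ ↦ Int.gcd (q : ℤ) a = 1), g q := by
        rw [sum_add_distrib, sum_add_distrib, sum_const, nsmul_eq_mul, mul_one, ← sum_filter,
          ← sum_filter, sum_const, nsmul_eq_mul, filter_filter, mul_sum, mul_comm (y : ℝ)]

/-- **The prime number theorem in the rows**: if `π(x) ≤ (1 + ε) x/log x` for `x ≥ x₀`, `N ≥ 1`,
and every `q ∈ D` has `log q ≥ 1`, `x₀ ≤ q log^N q` and `q ≤ Q₂`, then
`∑_{q ∈ D, (q,a)=1} π(q log^N q)/φ(q) ≤ (1+ε) (log Q₂)^{N−1} ∑_{q ∈ D, (q,a)=1} q/φ(q)`.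
[cite: FriedlanderGranville1992, §5 (the display before (5.8))] -/
theorem sum_primeCounting_div_le {Q₁ Q₂ P : ℕ} {a : ℤ} {N ε x₀ : ℝ} (hN : 1 ≤ N) (hε : 0 ≤ ε)
    (hπ : ∀ x : ℝ, x₀ ≤ x → (Nat.primeCounting ⌊x⌋₊ : ℝ) ≤ (1 + ε) * (x / Real.log x))
    (hlog : ∀ q ∈ moduliSet Q₁ Q₂ P a, 1 ≤ Real.log q)
    (hx₀ : ∀ q ∈ moduliSet Q₁ Q₂ P a, x₀ ≤ (q : ℝ) * Real.log q ^ N) :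
    ∑ q ∈ (moduliSet Q₁ Q₂ P a).filter (fun q : ℕ ↦ Int.gcd (q : ℤ) a = 1),
        (Nat.primeCounting ⌊(q : ℝ) * Real.log q ^ N⌋₊ : ℝ) / (Nat.totient q : ℝ) ≤
      (1 + ε) * Real.log Q₂ ^ (N - 1) *
        ∑ q ∈ (moduliSet Q₁ Q₂ P a).filter (fun q : ℕ ↦ Int.gcd (q : ℤ) a = 1),
          (q : ℝ) / (Nat.totient q : ℝ) := by
  rw [mul_sum]
  refine sum_le_sum fun q hq ↦ ?_
  have hqD := (mem_filter.1 hq).1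
  have hqD' := mem_moduliSet.1 hqD
  have hq0 : (0 : ℝ) < q := by exact_mod_cast (show 0 < q by omega)
  have hq1 : 1 ≤ q := by omega
  have hφ : (0 : ℝ) < q.totient := by exact_mod_cast Nat.totient_pos.2 hq1
  have hlq := hlog q hqD
  have hlq0 : 0 < Real.log q := by linarith
  have hpowpos : 0 < Real.log q ^ N := Real.rpow_pos_of_pos hlq0 N
  have hpow1 : 1 ≤ Real.log q ^ N := Real.one_le_rpow hlq (by linarith)
  set x : ℝ := (q : ℝ) * Real.log q ^ N with hx
  have hxq : (q : ℝ) ≤ x := by rw [hx]; exact le_mul_of_one_le_right hq0.le hpow1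
  have hx0 : 0 < x := lt_of_lt_of_le hq0 hxq
  have hlogx : Real.log q ≤ Real.log x := Real.log_le_log hq0 hxq
  have h1 := hπ x (hx₀ q hqD)
  -- `x / log x ≤ x / log q = q (log q)^{N-1}`
  have h2 : x / Real.log x ≤ (q : ℝ) * Real.log q ^ (N - 1) := by
    calc x / Real.log x ≤ x / Real.log q := div_le_div_of_nonneg_left hx0.le hlq0 hlogx
      _ = (q : ℝ) * Real.log q ^ (N - 1) := by
          rw [hx, div_eq_iff hlq0.ne', mul_assoc, ← Real.rpow_add_one hlq0.ne', sub_add_cancel]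
  have h3 : Real.log q ^ (N - 1) ≤ Real.log Q₂ ^ (N - 1) := by
    refine Real.rpow_le_rpow hlq0.le ?_ (by linarith)
    exact Real.log_le_log hq0 (by exact_mod_cast hqD'.1.2)
  have h4 : (Nat.primeCounting ⌊x⌋₊ : ℝ) ≤ (1 + ε) * ((q : ℝ) * Real.log Q₂ ^ (N - 1)) := by
    calc (Nat.primeCounting ⌊x⌋₊ : ℝ) ≤ (1 + ε) * (x / Real.log x) := h1
      _ ≤ (1 + ε) * ((q : ℝ) * Real.log q ^ (N - 1)) := mul_le_mul_of_nonneg_left h2 (by linarith)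
      _ ≤ (1 + ε) * ((q : ℝ) * Real.log Q₂ ^ (N - 1)) :=
          mul_le_mul_of_nonneg_left (mul_le_mul_of_nonneg_left h3 hq0.le) (by linarith)
  calc (Nat.primeCounting ⌊x⌋₊ : ℝ) / (q.totient : ℝ) ≤ (1 + ε) * ((q : ℝ) * Real.log Q₂ ^ (N - 1)) / q.totient :=
        div_le_div_of_nonneg_right h4 hφ.le
    _ = (1 + ε) * Real.log Q₂ ^ (N - 1) * ((q : ℝ) / q.totient) := by ring

/-! ## The rows, from below (for (1.6)) -/

/-- **The sum of the rows from below**: if every modulus of `D` exceeds `|a|`,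
`q log^N q ≤ a + yq` on `D`, `Λ₀ ≤ π(q log^N q)/q` on `D` and `(1−δ)Λ₀ ≥ 1`, then
`(#{q ∈ D : (q,a)=1} − #{violators of (1.6)}) ((1−δ)Λ₀ − 1) ≤ ∑_{q ∈ D} #{r ≤ y : a + rq prime}`
(a non-violating coprime row holds at least `π(x_q; q, a) − 1 ≥ (1−δ)π(x_q)/φ(q) − 1` primes).
[cite: FriedlanderGranville1992, §1 (1.6) and §5 ("the modifications required to prove (1.6) are minor")] -/
theorem card_mul_le_sum_rows {Q₁ Q₂ P y : ℕ} {a : ℤ} {N δ Lam : ℝ} (ha : a.natAbs ≤ Q₁) (hδ : δ ≤ 1)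
    (hy : ∀ q ∈ moduliSet Q₁ Q₂ P a, (q : ℝ) * Real.log q ^ N ≤ (a : ℝ) + y * q)
    (hLam : ∀ q ∈ moduliSet Q₁ Q₂ P a, Lam ≤ (Nat.primeCounting ⌊(q : ℝ) * Real.log q ^ N⌋₊ : ℝ) / q)
    (hLam1 : 0 ≤ (1 - δ) * Lam - 1) :
    ((#((moduliSet Q₁ Q₂ P a).filter fun q : ℕ ↦ Int.gcd (q : ℤ) a = 1) : ℝ) -
        #(((moduliSet Q₁ Q₂ P a).filter fun q : ℕ ↦ Int.gcd (q : ℤ) a = 1).filter fun q : ℕ ↦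
          (primeCountingModInt q a ((q : ℝ) * Real.log q ^ N) : ℝ) <
            (1 - δ) * ((Nat.primeCounting ⌊(q : ℝ) * Real.log q ^ N⌋₊ : ℝ) / (Nat.totient q : ℝ)))) *
        ((1 - δ) * Lam - 1) ≤
      ∑ q ∈ moduliSet Q₁ Q₂ P a, (rowCount a y q : ℝ) := by
  classical
  set D := moduliSet Q₁ Q₂ P a with hD
  set C := D.filter fun q : ℕ ↦ Int.gcd (q : ℤ) a = 1 with hC
  set viol : ℕ → Prop := fun q ↦ (primeCountingModInt q a ((q : ℝ) * Real.log q ^ N) : ℝ) <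
      (1 - δ) * ((Nat.primeCounting ⌊(q : ℝ) * Real.log q ^ N⌋₊ : ℝ) / (Nat.totient q : ℝ)) with hviol
  set Good := C.filter fun q ↦ ¬ viol q with hGood
  have hcard : (#C : ℝ) - #(C.filter viol) ≤ #Good := by
    have := Finset.card_filter_add_card_filter_not (s := C) viol
    have h : (#(C.filter viol) : ℝ) + #Good = #C := by rw [hGood]; exact_mod_cast this
    linarith
  have hGoodsub : Good ⊆ D := (filter_subset _ _).trans (filter_subset _ _)
  have hpt : ∀ q ∈ Good, (1 - δ) * Lam - 1 ≤ (rowCount a y q : ℝ) := by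
    intro q hq
    rw [hGood, mem_filter, hC, mem_filter] at hq
    obtain ⟨⟨hqD, hcop⟩, hv⟩ := hq
    have hqD' := mem_moduliSet.1 hqD
    have hq1 : Q₁ + 1 ≤ q := hqD'.1.1
    have hqa : (a.natAbs : ℤ) < q := by
      have : a.natAbs < q := by omega
      exact_mod_cast this
    have hq0 : (0 : ℝ) < q := by exact_mod_cast (show 0 < q by omega)
    have hφq : (q.totient : ℝ) ≤ q := by exact_mod_cast Nat.totient_le q
    have hφ0 : (0 : ℝ) < q.totient := by exact_mod_cast Nat.totient_pos.2 (by omega)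
    have h1 := primeCountingModInt_le_rowCount_add_one (y := y) hqa (hy q hqD)
    have h1' : (primeCountingModInt q a ((q : ℝ) * Real.log q ^ N) : ℝ) ≤ rowCount a y q + 1 := by
      exact_mod_cast h1
    rw [hviol] at hv; push Not at hv
    have h2 := hLam q hqD
    set π₀ : ℝ := (Nat.primeCounting ⌊(q : ℝ) * Real.log q ^ N⌋₊ : ℝ) with hπ₀
    have hπ₀0 : 0 ≤ π₀ := Nat.cast_nonneg _
    have h3 : π₀ / q ≤ π₀ / q.totient := div_le_div_of_nonneg_left hπ₀0 hφ0 hφq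
    have h4 : (1 - δ) * Lam ≤ (1 - δ) * (π₀ / q.totient) :=
      mul_le_mul_of_nonneg_left (h2.trans h3) (by linarith)
    linarith
  calc ((#C : ℝ) - #(C.filter viol)) * ((1 - δ) * Lam - 1) ≤ #Good * ((1 - δ) * Lam - 1) :=
        mul_le_mul_of_nonneg_right hcard hLam1
    _ = ∑ q ∈ Good, ((1 - δ) * Lam - 1) := by rw [sum_const, nsmul_eq_mul]
    _ ≤ ∑ q ∈ Good, (rowCount a y q : ℝ) := sum_le_sum hpt
    _ ≤ ∑ q ∈ D, (rowCount a y q : ℝ) :=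
        sum_le_sum_of_subset_of_nonneg hGoodsub fun q _ _ ↦ Nat.cast_nonneg _


/-! ## The columns, from above (for (1.6)) -/

set_option maxHeartbeats 800000 in
/-- **The sum of the columns from above** (source (5.3)–(5.5), for the proof of (1.6)): with the
two-sided prime number theorem for the good live columns (`K ∤ r`), a Brun–Titchmarsh bound of
the shape `K_BT (X₂ʳ/(φ(rP) log z) + z^{10}) + z + 1` for the bad live columns (`K ∣ r`), and a
set of primes `Ps'` carrying the weights `rφ(P)/φ(rP) = primeWeight Ps' r`, the total number of
primes in the matrix is at most
`y + #live (X/P + 1 + 2√X_max log X_max/log X) + ((Q₂−Q₁) + ε(3Q₁+Q₂))/(φ(P) log X) ∑_{live} w_r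
 + (K_BT (Q₁+Q₂)/(φ(P) log z)) ∑_{live, K ∣ r} w_r + #{live : K ∣ r} (K_BT z^{10} + z + 1)`.
[cite: FriedlanderGranville1992, §5 (5.3)–(5.5)] -/
theorem sum_columns_le {Q₁ Q₂ P y K X : ℕ} {a : ℤ} {ε Xmax KBT z : ℝ} {Ps' : Finset ℕ}
    (hP : 1 ≤ P) (hQ : Q₁ ≤ Q₂) (ha : a.natAbs ≤ Q₁) (hX2 : 2 ≤ X)
    (hXQ : (X : ℝ) ≤ (a : ℝ) + Q₂) (hXmax : (a : ℝ) + y * Q₂ ≤ Xmax) (hXmax2 : 2 ≤ Xmax)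
    (hε : 0 ≤ ε) (hε1 : ε ≤ 1) (hKBT : 0 ≤ KBT) (hz : 1 < z)
    (hPs : ∀ p ∈ Ps', p.Prime) (hPsP : ∀ p ∈ Ps', ¬ p ∣ P)
    (hfac : ∀ r ∈ liveSet a y P, ∀ p ∈ r.primeFactors, ¬ p ∣ P → p ∈ Ps')
    (hψ : ∀ r ∈ (liveSet a y P).filter (fun r ↦ ¬ K ∣ r), ∀ x : ℝ, (X : ℝ) ≤ x →
      |ParityWave0.chebyshevPsiMod (r * P) ((colResidue a r P : ℕ) : ZMod (r * P)) x -
          x / ((r * P).totient : ℝ)| ≤ ε * (x / ((r * P).totient : ℝ)))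
    (hBT : ∀ r ∈ (liveSet a y P).filter (fun r ↦ K ∣ r),
      (colCount (r * P) (colResidue a r P) (colEnd a r Q₁) (colEnd a r Q₂) : ℝ) ≤
        KBT * (((colEnd a r Q₂ : ℕ) : ℝ) / (((r * P).totient : ℝ) * Real.log z) + z ^ (10 : ℕ)) + z + 1) :
    ∑ r ∈ Icc 1 y, (#{q ∈ moduliSet Q₁ Q₂ P a | (entry a r q).Prime} : ℝ) ≤
      y + #(liveSet a y P) * ((X : ℝ) / P + 1 + 2 * Real.sqrt Xmax * Real.log Xmax / Real.log X) +
        (((Q₂ : ℝ) - Q₁) + ε * (3 * Q₁ + Q₂)) / ((P.totient : ℝ) * Real.log X) *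
          ∑ r ∈ liveSet a y P, primeWeight Ps' r +
        KBT * ((Q₁ : ℝ) + Q₂) / ((P.totient : ℝ) * Real.log z) *
          ∑ r ∈ (liveSet a y P).filter (fun r ↦ K ∣ r), primeWeight Ps' r +
        #((liveSet a y P).filter fun r ↦ K ∣ r) * (KBT * z ^ (10 : ℕ) + z + 1) := by
  classical
  set L := liveSet a y P with hL
  set G := L.filter fun r ↦ ¬ K ∣ r with hG
  set Bd := L.filter fun r ↦ K ∣ r with hBd
  have hφP : (0 : ℝ) < P.totient := by exact_mod_cast Nat.totient_pos.2 hP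
  have hP0 : (0 : ℝ) < P := by exact_mod_cast hP
  have haQ₁ : -(Q₁ : ℤ) ≤ a ∧ a ≤ Q₁ := by
    have h := ha; constructor <;> cases Int.natAbs_eq a <;> omega
  have ha0 : 0 ≤ a + Q₁ := by linarith [haQ₁.1]
  have hX0 : (0 : ℝ) < X := by exact_mod_cast (by omega : 0 < X)
  have hX2R : (2 : ℝ) ≤ X := by exact_mod_cast hX2
  have hlogX : 0 < Real.log X := Real.log_pos (by linarith)
  have hlogz : 0 < Real.log z := Real.log_pos hz
  have hlogXmax : 0 ≤ Real.log Xmax := Real.log_nonneg (by linarith)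
  have hLsub : L ⊆ Icc 1 y := filter_subset _ _
  set cG : ℝ := (X : ℝ) / P + 1 + 2 * Real.sqrt Xmax * Real.log Xmax / Real.log X with hcG
  set κ : ℝ := (((Q₂ : ℝ) - Q₁) + ε * (3 * Q₁ + Q₂)) / ((P.totient : ℝ) * Real.log X) with hκ
  set β : ℝ := KBT * ((Q₁ : ℝ) + Q₂) / ((P.totient : ℝ) * Real.log z) with hβ
  set cB : ℝ := KBT * z ^ (10 : ℕ) + z + 1 with hcB
  have hcG0 : 0 ≤ cG := by rw [hcG]; positivity
  have hκ0 : 0 ≤ κ := by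
    have : (Q₁ : ℝ) ≤ Q₂ := by exact_mod_cast hQ
    rw [hκ]; exact div_nonneg (by nlinarith [(Nat.cast_nonneg Q₁ : (0:ℝ) ≤ Q₁)]) (by positivity)
  have hβ0 : 0 ≤ β := by rw [hβ]; positivity
  have hcB0 : 0 ≤ cB := by rw [hcB]; positivity
  have hw0 : ∀ r, 0 ≤ primeWeight Ps' r := fun r ↦ le_trans zero_le_one (one_le_primeWeight hPs r)
  -- common facts for a live column
  have hcolfacts : ∀ r ∈ L, 1 ≤ r ∧ r ≤ y ∧
      ((colEnd a r Q₁ : ℕ) : ℝ) = (a : ℝ) + r * Q₁ ∧ ((colEnd a r Q₂ : ℕ) : ℝ) = (a : ℝ) + r * Q₂ ∧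
      colEnd a r Q₁ ≤ colEnd a r Q₂ ∧ (X : ℝ) ≤ colEnd a r Q₂ ∧ ((colEnd a r Q₂ : ℕ) : ℝ) ≤ Xmax ∧
      (r : ℝ) * (P.totient : ℝ) = ((r * P).totient : ℝ) * primeWeight Ps' r := by
    intro r hr
    have hr' := hLsub hr
    rw [mem_Icc] at hr'
    obtain ⟨hr1, hry⟩ := hr'
    have hr0 : (0 : ℤ) < r := by exact_mod_cast hr1
    have hr1R : (1 : ℝ) ≤ r := by exact_mod_cast hr1
    have hryR : (r : ℝ) ≤ y := by exact_mod_cast hry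
    have hX₁nn : 0 ≤ a + (r : ℤ) * (Q₁ : ℤ) := by nlinarith
    have hX₂nn : 0 ≤ a + (r : ℤ) * (Q₂ : ℤ) := by
      have : (Q₁ : ℤ) ≤ Q₂ := by exact_mod_cast hQ
      nlinarith
    have hX₁R : ((colEnd a r Q₁ : ℕ) : ℝ) = (a : ℝ) + r * Q₁ := by
      have := colEnd_cast hX₁nn; exact_mod_cast this
    have hX₂R : ((colEnd a r Q₂ : ℕ) : ℝ) = (a : ℝ) + r * Q₂ := by
      have := colEnd_cast hX₂nn; exact_mod_cast this
    have hQ₁R : (0 : ℝ) ≤ Q₁ := Nat.cast_nonneg Q₁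
    have hQ₂R : (Q₁ : ℝ) ≤ Q₂ := by exact_mod_cast hQ
    have h12 : colEnd a r Q₁ ≤ colEnd a r Q₂ := by
      have : ((colEnd a r Q₁ : ℕ) : ℝ) ≤ colEnd a r Q₂ := by rw [hX₁R, hX₂R]; nlinarith
      exact_mod_cast this
    have hXX₂ : (X : ℝ) ≤ colEnd a r Q₂ := by
      rw [hX₂R]
      have : (Q₂ : ℝ) ≤ r * Q₂ := by nlinarith
      linarith
    have hX₂max : ((colEnd a r Q₂ : ℕ) : ℝ) ≤ Xmax := by
      rw [hX₂R]
      have : (r : ℝ) * Q₂ ≤ y * Q₂ := by nlinarith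
      linarith
    have hweight := totient_mul_weight hPs (by omega : r ≠ 0) (by omega : P ≠ 0) (hfac r hr) hPsP
    exact ⟨hr1, hry, hX₁R, hX₂R, h12, hXX₂, hX₂max, hweight⟩
  -- pointwise bound
  have hpt : ∀ r ∈ Icc 1 y, (#{q ∈ moduliSet Q₁ Q₂ P a | (entry a r q).Prime} : ℝ) ≤
      1 + (if r ∈ G then cG + κ * primeWeight Ps' r else 0) +
        (if r ∈ Bd then β * primeWeight Ps' r + cB else 0) := by
    intro r hr
    rw [mem_Icc] at hr
    obtain ⟨hr1, hry⟩ := hr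
    have hM0 : 0 < r * P := Nat.mul_pos hr1 hP
    have hC : #{q ∈ moduliSet Q₁ Q₂ P a | (entry a r q).Prime} =
        colCount (r * P) (colResidue a r P) (colEnd a r Q₁) (colEnd a r Q₂) :=
      card_column_eq_colCount hr1 hP hQ ha0
    rw [hC]
    have hGnn : 0 ≤ (if r ∈ G then cG + κ * primeWeight Ps' r else 0) := by
      split_ifs
      · exact add_nonneg hcG0 (mul_nonneg hκ0 (hw0 r))
      · exact le_rfl
    have hBnn : 0 ≤ (if r ∈ Bd then β * primeWeight Ps' r + cB else 0) := by
      split_ifs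
      · exact add_nonneg (mul_nonneg hβ0 (hw0 r)) hcB0
      · exact le_rfl
    by_cases hlive : r ∈ L
    · obtain ⟨-, -, hX₁R, hX₂R, h12, hXX₂, hX₂max, hweight⟩ := hcolfacts r hlive
      set M := r * P with hM
      set j := colResidue a r P with hj
      set X₁ := colEnd a r Q₁ with hX₁def
      set X₂ := colEnd a r Q₂ with hX₂def
      have hφM : (0 : ℝ) < M.totient := by exact_mod_cast Nat.totient_pos.2 hM0
      have hr1R : (1 : ℝ) ≤ r := by exact_mod_cast hr1
      have haR : (a : ℝ) ≤ Q₁ := by exact_mod_cast haQ₁.2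
      have hQ₁R : (0 : ℝ) ≤ Q₁ := Nat.cast_nonneg Q₁
      -- `r/φ(M) = w/φ(P)`
      have hrφ : (r : ℝ) / M.totient = primeWeight Ps' r / P.totient := by
        rw [div_eq_div_iff hφM.ne' hφP.ne', hweight]; ring
      by_cases hK : K ∣ r
      · -- bad live column: Brun–Titchmarsh
        have hrBd : r ∈ Bd := mem_filter.2 ⟨hlive, hK⟩
        have hrG : r ∉ G := fun h ↦ (mem_filter.1 h).2 hK
        rw [if_neg hrG, if_pos hrBd, add_zero]
        have h1 := hBT r hrBd
        -- `X₂ ≤ r (Q₁ + Q₂)`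
        have hX₂le : ((X₂ : ℕ) : ℝ) ≤ r * ((Q₁ : ℝ) + Q₂) := by rw [hX₂R]; nlinarith
        have h2 : ((X₂ : ℕ) : ℝ) / ((M.totient : ℝ) * Real.log z) ≤
            ((Q₁ : ℝ) + Q₂) / ((P.totient : ℝ) * Real.log z) * primeWeight Ps' r := by
          calc ((X₂ : ℕ) : ℝ) / ((M.totient : ℝ) * Real.log z)
              ≤ (r * ((Q₁ : ℝ) + Q₂)) / ((M.totient : ℝ) * Real.log z) :=
                div_le_div_of_nonneg_right hX₂le (by positivity)
            _ = ((r : ℝ) / M.totient) * (((Q₁ : ℝ) + Q₂) / Real.log z) := by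
                field_simp
            _ = (primeWeight Ps' r / P.totient) * (((Q₁ : ℝ) + Q₂) / Real.log z) := by rw [hrφ]
            _ = ((Q₁ : ℝ) + Q₂) / ((P.totient : ℝ) * Real.log z) * primeWeight Ps' r := by
                field_simp
        have h3 : KBT * (((X₂ : ℕ) : ℝ) / ((M.totient : ℝ) * Real.log z) + z ^ (10 : ℕ)) + z + 1 ≤
            β * primeWeight Ps' r + cB := by
          rw [hβ, hcB]
          have := mul_le_mul_of_nonneg_left h2 hKBT
          have e : KBT * (((Q₁ : ℝ) + Q₂) / ((P.totient : ℝ) * Real.log z) * primeWeight Ps' r) =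
              KBT * ((Q₁ : ℝ) + Q₂) / ((P.totient : ℝ) * Real.log z) * primeWeight Ps' r := by ring
          nlinarith [this, e]
        linarith
      · -- good live column: the prime number theorem
        have hrG : r ∈ G := mem_filter.2 ⟨hlive, hK⟩
        have hrBd : r ∉ Bd := fun h ↦ hK (mem_filter.1 h).2
        rw [if_pos hrG, if_neg hrBd, add_zero]
        have hWX : X ≤ X₂ := by exact_mod_cast hXX₂
        have hup := colCount_le hM0 j h12 hX2 hWX
        set W' : ℕ := max X₁ X with hW'
        have hW'X : (X : ℝ) ≤ W' := by exact_mod_cast le_max_right X₁ X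
        have hW'X₁ : (X₁ : ℝ) ≤ W' := by exact_mod_cast le_max_left X₁ X
        have hW'X₂ : (W' : ℝ) ≤ X₂ := by exact_mod_cast (max_le h12 hWX)
        have hW'pos : (0 : ℝ) < W' := lt_of_lt_of_le hX0 hW'X
        -- PNT at `X₂` and at `W'`
        have hψ₂ := hψ r hrG (X₂ : ℝ) hXX₂
        have hψW := hψ r hrG (W' : ℝ) hW'X
        rw [abs_le] at hψ₂ hψW
        -- Chebyshev at `W'`
        have hcheb : Chebyshev.psi W' - Chebyshev.theta W' ≤ 2 * Real.sqrt Xmax * Real.log Xmax := by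
          have h1 := Chebyshev.abs_psi_sub_theta_le_sqrt_mul_log (x := (W' : ℝ)) (by linarith)
          rw [abs_le] at h1
          have hW'max : (W' : ℝ) ≤ Xmax := hW'X₂.trans hX₂max
          have h2 : Real.sqrt W' ≤ Real.sqrt Xmax := Real.sqrt_le_sqrt hW'max
          have h3 : Real.log W' ≤ Real.log Xmax := Real.log_le_log hW'pos hW'max
          have h4 : 0 ≤ Real.log (W' : ℝ) := Real.log_nonneg (by linarith)
          calc Chebyshev.psi W' - Chebyshev.theta W' ≤ 2 * Real.sqrt W' * Real.log W' := h1.2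
            _ ≤ 2 * Real.sqrt Xmax * Real.log W' :=
                mul_le_mul_of_nonneg_right (mul_le_mul_of_nonneg_left h2 (by norm_num)) h4
            _ ≤ 2 * Real.sqrt Xmax * Real.log Xmax := mul_le_mul_of_nonneg_left h3 (by positivity)
        -- the `ψ`-difference
        have hdiff : ParityWave0.chebyshevPsiMod M (j : ZMod M) X₂ -
            ParityWave0.chebyshevPsiMod M (j : ZMod M) W' ≤
            ((1 + ε) * (X₂ : ℝ) - (1 - ε) * X₁) / M.totient := by
          have e1 : ParityWave0.chebyshevPsiMod M (j : ZMod M) X₂ ≤ (1 + ε) * ((X₂ : ℝ) / M.totient) := by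
            linarith [hψ₂.2]
          have e2 : (1 - ε) * ((W' : ℝ) / M.totient) ≤ ParityWave0.chebyshevPsiMod M (j : ZMod M) W' := by
            linarith [hψW.1]
          have e3 : (1 - ε) * ((X₁ : ℝ) / M.totient) ≤ (1 - ε) * ((W' : ℝ) / M.totient) :=
            mul_le_mul_of_nonneg_left (div_le_div_of_nonneg_right hW'X₁ hφM.le) (by linarith)
          have e4 : (1 + ε) * ((X₂ : ℝ) / M.totient) - (1 - ε) * ((X₁ : ℝ) / M.totient) =
              ((1 + ε) * (X₂ : ℝ) - (1 - ε) * X₁) / M.totient := by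
            field_simp
          linarith
        -- `(1+ε)X₂ − (1−ε)X₁ ≤ r (ΔQ + ε Σ)`
        have hB : (1 + ε) * ((X₂ : ℕ) : ℝ) - (1 - ε) * X₁ ≤ (r : ℝ) * (((Q₂ : ℝ) - Q₁) + ε * (3 * Q₁ + Q₂)) := by
          have key : (r : ℝ) * (((Q₂ : ℝ) - Q₁) + ε * (3 * Q₁ + Q₂)) -
              ((1 + ε) * ((X₂ : ℕ) : ℝ) - (1 - ε) * X₁) = 2 * ε * (r * Q₁ - a) := by
            rw [hX₁R, hX₂R]; ring
          have h1 : (a : ℝ) ≤ r * Q₁ := haR.trans (le_mul_of_one_le_left hQ₁R hr1R)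
          have h2 : 0 ≤ 2 * ε * ((r : ℝ) * Q₁ - a) := mul_nonneg (by positivity) (by linarith)
          linarith
        have hmain : ((1 + ε) * (X₂ : ℝ) - (1 - ε) * X₁) / M.totient ≤
            (((Q₂ : ℝ) - Q₁) + ε * (3 * Q₁ + Q₂)) / P.totient * primeWeight Ps' r := by
          calc ((1 + ε) * (X₂ : ℝ) - (1 - ε) * X₁) / M.totient
              ≤ (r : ℝ) * (((Q₂ : ℝ) - Q₁) + ε * (3 * Q₁ + Q₂)) / M.totient :=
                div_le_div_of_nonneg_right hB hφM.le
            _ = ((r : ℝ) / M.totient) * (((Q₂ : ℝ) - Q₁) + ε * (3 * Q₁ + Q₂)) := by ring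
            _ = (primeWeight Ps' r / P.totient) * (((Q₂ : ℝ) - Q₁) + ε * (3 * Q₁ + Q₂)) := by rw [hrφ]
            _ = _ := by ring
        -- the trivial part `X/(rP) ≤ X/P`
        have hXP : (X : ℝ) / ((M : ℕ) : ℝ) ≤ (X : ℝ) / P := by
          have : (P : ℝ) ≤ ((M : ℕ) : ℝ) := by
            rw [hM]; push_cast; nlinarith
          exact div_le_div_of_nonneg_left hX0.le hP0 this
        -- assemble
        have hnum : ParityWave0.chebyshevPsiMod M (j : ZMod M) X₂ -
            ParityWave0.chebyshevPsiMod M (j : ZMod M) W' + (Chebyshev.psi W' - Chebyshev.theta W') ≤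
            (((Q₂ : ℝ) - Q₁) + ε * (3 * Q₁ + Q₂)) / P.totient * primeWeight Ps' r +
              2 * Real.sqrt Xmax * Real.log Xmax := by linarith
        have hdiv := div_le_div_of_nonneg_right hnum hlogX.le
        have e5 : ((((Q₂ : ℝ) - Q₁) + ε * (3 * Q₁ + Q₂)) / P.totient * primeWeight Ps' r +
            2 * Real.sqrt Xmax * Real.log Xmax) / Real.log X =
            κ * primeWeight Ps' r + 2 * Real.sqrt Xmax * Real.log Xmax / Real.log X := by
          rw [hκ]; field_simp
        rw [e5] at hdiv
        rw [hcG]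
        have hup' : (colCount M j X₁ X₂ : ℝ) ≤ (X : ℝ) / ((M : ℕ) : ℝ) + 1 +
            (ParityWave0.chebyshevPsiMod M (j : ZMod M) X₂ -
              ParityWave0.chebyshevPsiMod M (j : ZMod M) W' + (Chebyshev.psi W' - Chebyshev.theta W')) /
              Real.log X := by
          exact hup
        linarith
    · -- dead column
      have hrG : r ∉ G := fun h ↦ hlive (mem_filter.1 h).1
      have hrBd : r ∉ Bd := fun h ↦ hlive (mem_filter.1 h).1
      rw [if_neg hrG, if_neg hrBd, add_zero, add_zero]
      have hncop : ¬ (colResidue a r P).Coprime (r * P) := by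
        intro hcop
        apply hlive
        have haP : IsCoprime a (P : ℤ) := by
          -- from the coprimality of the column residue itself: `(a(r+1), rP) = 1 ⇒ (a, P) = 1`
          have h1 := (ZMod.isUnit_iff_coprime _ _).2 hcop
          rw [colResidue_zmod a hM0, ZMod.coe_int_isUnit_iff_isCoprime, isCoprime_comm,
            IsCoprime.mul_left_iff] at h1
          have h2 := h1.1
          push_cast at h2
          rw [IsCoprime.mul_right_iff] at h2
          exact h2.2
        rw [hL, liveSet, mem_filter, mem_Icc]
        exact ⟨⟨hr1, hry⟩, (coprime_colResidue_iff hr1 hP haP).1 hcop⟩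
      exact_mod_cast colCount_le_one_of_not_coprime hncop _ _
  -- sum the pointwise bound
  have hGsub : G ⊆ Icc 1 y := (filter_subset _ _).trans hLsub
  have hBsub : Bd ⊆ Icc 1 y := (filter_subset _ _).trans hLsub
  have e1 : ∑ r ∈ Icc 1 y, (1 : ℝ) = y := by simp
  have e2 : ∑ r ∈ Icc 1 y, (if r ∈ G then cG + κ * primeWeight Ps' r else 0) =
      ∑ r ∈ G, (cG + κ * primeWeight Ps' r) := by
    rw [sum_ite_mem, inter_eq_right.2 hGsub]
  have e3 : ∑ r ∈ Icc 1 y, (if r ∈ Bd then β * primeWeight Ps' r + cB else 0) =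
      ∑ r ∈ Bd, (β * primeWeight Ps' r + cB) := by
    rw [sum_ite_mem, inter_eq_right.2 hBsub]
  have e4 : ∑ r ∈ G, (cG + κ * primeWeight Ps' r) = #G * cG + κ * ∑ r ∈ G, primeWeight Ps' r := by
    rw [sum_add_distrib, sum_const, nsmul_eq_mul, mul_sum]
  have e5 : ∑ r ∈ Bd, (β * primeWeight Ps' r + cB) = β * ∑ r ∈ Bd, primeWeight Ps' r + #Bd * cB := by
    rw [sum_add_distrib, sum_const, nsmul_eq_mul, mul_sum]
  have h1 : (#G : ℝ) * cG ≤ #L * cG :=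
    mul_le_mul_of_nonneg_right (by exact_mod_cast card_le_card (filter_subset _ _)) hcG0
  have h2 : κ * ∑ r ∈ G, primeWeight Ps' r ≤ κ * ∑ r ∈ L, primeWeight Ps' r :=
    mul_le_mul_of_nonneg_left
      (sum_le_sum_of_subset_of_nonneg (filter_subset _ _) fun r _ _ ↦ hw0 r) hκ0
  have hsum : ∑ r ∈ Icc 1 y, (#{q ∈ moduliSet Q₁ Q₂ P a | (entry a r q).Prime} : ℝ) ≤
      y + (#G * cG + κ * ∑ r ∈ G, primeWeight Ps' r) + (β * ∑ r ∈ Bd, primeWeight Ps' r + #Bd * cB) := by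
    calc ∑ r ∈ Icc 1 y, (#{q ∈ moduliSet Q₁ Q₂ P a | (entry a r q).Prime} : ℝ)
        ≤ ∑ r ∈ Icc 1 y, (1 + (if r ∈ G then cG + κ * primeWeight Ps' r else 0) +
            (if r ∈ Bd then β * primeWeight Ps' r + cB else 0)) := sum_le_sum hpt
      _ = y + (#G * cG + κ * ∑ r ∈ G, primeWeight Ps' r) + (β * ∑ r ∈ Bd, primeWeight Ps' r + #Bd * cB) := by
          rw [sum_add_distrib, sum_add_distrib, e1, e2, e3, e4, e5]
  have hfinal : (y : ℝ) + (#G * cG + κ * ∑ r ∈ G, primeWeight Ps' r) + (β * ∑ r ∈ Bd, primeWeight Ps' r + #Bd * cB) ≤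
      y + #L * cG + κ * ∑ r ∈ L, primeWeight Ps' r + β * ∑ r ∈ Bd, primeWeight Ps' r + #Bd * cB := by
    linarith
  have eκ : κ * ∑ r ∈ L, primeWeight Ps' r =
      (((Q₂ : ℝ) - Q₁) + ε * (3 * Q₁ + Q₂)) / ((P.totient : ℝ) * Real.log X) * ∑ r ∈ L, primeWeight Ps' r := by
    rw [hκ]
  have eβ : β * ∑ r ∈ Bd, primeWeight Ps' r =
      KBT * ((Q₁ : ℝ) + Q₂) / ((P.totient : ℝ) * Real.log z) * ∑ r ∈ Bd, primeWeight Ps' r := by rw [hβ]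
  have ecG : (#L : ℝ) * cG = #L * ((X : ℝ) / P + 1 + 2 * Real.sqrt Xmax * Real.log Xmax / Real.log X) := by
    rw [hcG]
  have ecB : (#Bd : ℝ) * cB = #Bd * (KBT * z ^ (10 : ℕ) + z + 1) := by rw [hcB]
  linarith [hsum, hfinal, eκ, eβ, ecG, ecB]

end Literature.Barriers.Parity.FriedlanderGranville
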